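import Literature.MathematicalPhysics.QuantumFieldTheory.Balaban1983to89.B9SectBStepWhole
import Literature.MathematicalPhysics.QuantumFieldTheory.Balaban1983to89.B9Thm34SectBUniformR1
import Literature.MathematicalPhysics.QuantumFieldTheory.Balaban1983to89.B9Thm34HolderGpUniformR1

/-!
# `Balaban1983to89.B9SectBGpStepAtLettersV2` — [B9] Sect. B, the steps of Theorem 3.4 for the G′ family PINNED AT THE LETTERS of the
# tree's Sect. B programme, FRAMES V2: the letters dictionaries `GpFrame₂` ∕ `CinvFrame₂` ∕ `GlobFrame₂` ∕ `H1Frame₂` ∕ `E4H2Frame₂` ∕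
# `AnFrame₂` with the [4] Lemma-2.1 fields M-THRESHOLDED AND RATE-CAPPED (the v1 fields of `B9SectBGpStepAtLetters` were unsatisfiable
# over a multiscale family — LOCATED-4), and ★ `stepEPos_of_gpFrame₂`, ★ `stepKerPos_of_cinvFrame₂`, ★ `stepGlobPos_of_globFrame₂`,
# ★ `stepH1Pos_of_h1Frame₂`, ★ `stepE4Pos_of_e4h2Frame₂` ∕ `stepH2Pos_of_e4h2Frame₂`, ★ `stepAnalyticPos1_of_anFrame₂` over the R1-restated
# r06 theorems (`B9Thm34SectBUniformR1`, `B9Thm34HolderGpUniformR1`)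

T. Bałaban, *Propagators for lattice gauge theories in a background field*, Commun. Math. Phys. **99** (1985) 389–434
[`Balaban1985BackgroundPropagators`, "B9"]; [4] = T. Bałaban, *Propagators and renormalization transformations for lattice
gauge theories. II*, Commun. Math. Phys. **96** (1984) 223–250 [`Balaban1984PropagatorsII`].

statement-level skeleton of published theorems with citation tags; proofs where landed; nothing here is a claim about the
Yang–Mills mass gap

THE PRINTED LOCUS (verbatim).  Theorem 3.4, p. 400: *"There exists a positive constant a₁ such that the operators G′(U),
(Q′(U)G′²(U)Q′*(U))⁻¹, R(U), G(U) extend to configurations U′U for α₁ ≦ a₁ as analytic functions of A. The extended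
operators satisfy all the inequalities of Theorems 3.1–3.3 correspondingly."*; p. 402, (3.60): *"Δ′_a(U′U) = Δ′_a(U) − V′(A),
where the operator V′(A) is defined by the last equality"*; (3.64): *"G′(U′U) = G′(U)(I − V′(A)G′(U))⁻¹ = Σ_{n=0}^∞
G′(U)(V′(A)G′(U))ⁿ"*; p. 403 l. 1–9: *"applying Theorem 3.1 for G′(U), the bound (3.63), the representation (3.64) and Lemma 2.1
of [4] we can prove all the statements (3.42)–(3.47) of Theorem 3.1 for the operator G′(U′U), of course with different constants"*;
(3.65)–(3.67) p. 403: *"The inverse satisfies Theorem 3.2"*.  [4] Lemma 2.1 p. 234: *"For the numbers α, 0 < α < 1, c₁(α) = 12c₀(½α),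
and RM satisfying (2.59) … (2.60) … (2.61)"*; (2.59) p. 233: *"Now we require that RM is sufficiently large, i.e. we assume
¼αδ₀RM > 2d log c₀(½α) + 1. (2.59)"*; B9 p. 398 after (3.47): *"Using Lemma 2.1 in [4] we may replace the factor (Lʲη)^α by
(Lʲη)^β(L^{j′}η)^γ with β + γ = α"*.

THE POINT (v2; why a second file).  `B9SectBGpStepAtLetters` (v1–v1.2, this seat's gen 2) wrote the letters dictionary between the
cell's abstract readings `B9.KernelFamily` and r06's Sect.-B letters as structures `GpFrame` ⊂ `CinvFrame`, `GlobFrame`, `H1Frame`,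
`E4H2Frame`, `L2Frame` (+ `AnFrame`), field shapes = the hypotheses of r06's uniform theorems VERBATIM, and proved that every frame
inhabits the corresponding positive-input step of `B9SectBStepWhole`.  Two of those verbatim field shapes turned out to be
UNSATISFIABLE over the geometry of any UV-limit record (this seat's gen 3, LOCATED-4): r06's theorems hypothesise [4] Lemma 2.1 as
«`∀ α, 0 < α → α < 1 → Ineq261 d 𝔅 δ α`» and the p. 398 scale transfer as «`∀ α, 0 < α → ScaleTransfer …`», at every rate and
with NO M-threshold — but print's (2.61) holds only «for RM satisfying (2.59)», a threshold that grows without bound as α → 0; over a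
family with unboundedly many scales at fixed M the v1 fields `h261`/`hST` are therefore false, and the v1 ★ theorems, though
correct, are vacuous there.  The repair has two halves: (R1) r06's theorems use the two binders at finitely many literal exponents
≥ 9/5000 only, so they have been RESTATED with `9/5000 ≤ α →` in place of `0 < α →` (sibling modules `B9Thm34SectBUniformR1`,
`B9Thm34GUniformR1`, `B9Thm34HolderGpUniformR1`; proofs verbatim); (R2, THIS FILE) the frames' Lemma-2.1 fields become
  `h261 : ∀ i δ α, 0 < δ → δ ≤ δcap → 9/5000 ≤ α → α < 1 → M261 δ ≤ (geo i).M → Ineq261 (d261 δ) (toB6 (geo i) …) δ α`,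
  `hST  : ∀ i δ α, 0 < δ → δ ≤ δcap → 9/5000 ≤ α → MST δ ≤ (geo i).M → ⟨the six scale transfers with Λf δ α⟩`
with frame-level threshold functions `M261 MST : ℝ → ℝ` (print's (2.59), resp. the size condition `L^{|γ|}e^{−αδRM} ≦ 1` of
`B9Ineq347.scaleTransfer_of_260`), a RATE CAP `δcap` (the frame's choice) and (v2.1) a RATE-DEPENDENT EXPONENT `d261 : ℝ → ℕ` of the
printed-shape constant c₁ = 12c₀(½α)^{d} — r06 couples that exponent to the (3.48) pairing exponent, but a (3.48)-type kernel bound is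
the same inequality at every pairing exponent (`kerBound_exp_change`), so the steps call r06 at `d := d261 (rate δ₀)` and move the
kernel readings (exponent `dB`) across.  Every ★ step calls the r06 theorem at the CALL RATE `rate δ₀ := min δ₀ δcap` (inputs at
rate δ₀ are inputs at any smaller rate — `read342_le`; «of course with different constants») with the M-threshold `Mthr (rate δ₀) :=
max MInv (max (M261 ·) (MST ·))` and passes `h261_of` ∕ `hST_of` — so the output constants of a step are uniform in the member exactly
as before.  The transfer fields of `H1Frame₂` ∕ `E4H2Frame₂` quote r06's per-probe transfers
AT A CALL RATE `δc ≦ δ` (inputs at δc, outputs at 9δc/10 resp. 4δc/5) — the instance lowers its own U-side bounds from δ to δc.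
All other fields are the v1 fields byte for byte.  WHAT AN INSTANCE OWES for the two repaired fields (recorded, not proved here): at
the record geometry `geo9Y` they are SUPPLIED BY NAME by dag-n06-k's `B9RWSums347DefiniteFacesWindow` (p492612): `ineq261_fn_geo9Y`
(`∃ d261 M261, ∀ x δ α, 0 < δ → αlo ≤ α → α ≤ 1 → M261 δ ≤ M → Ineq261 (d261 δ) …` — the row sum Σ_{y′}e^{−κd(y,y′)} is antitone in κ,
so ONE constant ∕ threshold at κ = (9/5000)·δ serves every α ∈ [9/5000, 1], and `exists_le_c1` gives the rate's exponent) and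
`scaleTransfer6_window_geo9Y` (the six transfers with `Λf δ α := (ℓ+1)⁴` under `M ≥ 4 log(ℓ+1)∕((9/5000)·δ)`).  The (3.46) L² members are NOT framed here: their r06 route runs through the KERNEL
form of (3.42), which the lit-balaban desk (pub-ymgap ME #13, 2026-08-26) records as unsatisfied by Bałaban's own propagators on
multi-point blocks for d ≥ 3 (diagonal of (Δ′_a)⁻¹ ≳ η² vs a block-uniform `B(Lʲη)²(L^{j′}η)^{−d}`); they stay DISPLAYED positive-input
steps in the v2 capstone (`B9SectBStepFrameV2`).

WHAT IS IN THE FILE (0 sorry, 0 new named facts; standard axioms; `def`s: the structures + the two bookkeeping functions `GpFrame₂.rate`,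
`GpFrame₂.Mthr`).  §0 `kerBound_exp_change` ((3.48)-type kernel bounds are exponent-free).  §1 `GpFrame₂` (+ `rate`, `Mthr`, `h261_of`, `hST_of`, `read342_le`) and ★ `stepEPos_of_gpFrame₂ : GpFrame₂ … →
StepEPos d c35 geo bg Gp GA Cinv Gp`; §2 `CinvFrame₂` and ★ `stepKerPos_of_cinvFrame₂ : CinvFrame₂ … Cinv → StepKerPos F.dB …`; §3
`entries342_ext_of_gpFrame₂`, `GlobFrame₂` ∕ ★ `stepGlobPos_of_globFrame₂`, `H1Frame₂` ∕ ★ `stepH1Pos_of_h1Frame₂`; §4 `E4H2Frame₂` ∕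
`stepE4H2Pos_of_e4h2Frame₂` ∕ ★ `stepE4Pos_of_e4h2Frame₂` ∕ ★ `stepH2Pos_of_e4h2Frame₂`; §5 `AnFrame₂` ∕ ★ `stepAnalyticPos1_of_anFrame₂`.
Proofs = the v1 proofs with the call rate and the threshold threaded through; r06's `…R1.thm34_Gp_uniform` ∕ `thm34_Cinv_uniform` ∕
`thm34_Gp_holderLeft_uniform` ∕ `thm34_Gp_holderRight_uniform` ∕ `thm34_Gp_holderInput_uniform` USED BY NAME; uniqueness of two-sided
inverses identifies the family's `G′(U′U)` ∕ `C⁻¹(U′U)` with r06's extension ∕ `Tinv` as in v1.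

HONEST SCOPE.  Nothing of print is asserted and no operator of [B9] is constructed: the frames are hypothesis structures (the contract an
instance meets), NOT shown inhabited here (their inhabitant is the operator layer of record — NODE 00's `opsYOfRecord` — whose
obligations are the fields); the theorems are quantifier bookkeeping + uniqueness of two-sided inverses over r06's theorems.
9/5000 and the rate cap are proof devices, not printed numbers (print: «0 < α < 1» with (2.59); «of course with different
constants»).  Count-neutral; NOT a node discharge; nothing continuum ∕ OS ∕ mass-gap ∕ Clay.  Cell `pub-ymgap` (HUMAN RULING D-0062),
Track A node N06 [B9], N06-ASSIGNMENT row 13, seat `pub-ymgap-dag-n06-c` (g4), 2026-08-27 (v2.1 = v2 + `d261`, same day, in place; the only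
importer `B9SectBGStepAtLettersV2` takes its Lemma-2.1 input as an explicit datum and is unaffected).  v1 (`B9SectBGpStepAtLetters*`) stays
in the tree (it has an importer); this file supersedes it for instantiation purposes.
-/

noncomputable section

namespace Literature.MathematicalPhysics.QuantumFieldTheory.Balaban1983to89.B9SectBGpStepAtLettersV2

open Literature.MathematicalPhysics.QuantumFieldTheory.Balaban1983to89
open Literature.MathematicalPhysics.QuantumFieldTheory.Balaban1983to89.B6RandomWalk (HasMajorant hasMajorant_mono Triangle254 Ineq261)
open Literature.MathematicalPhysics.QuantumFieldTheory.Balaban1983to89.B9Thm34Ext (toB6)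
open Literature.MathematicalPhysics.QuantumFieldTheory.Balaban1983to89.B9Ineq347 (ScaleTransfer)
open Literature.MathematicalPhysics.QuantumFieldTheory.Balaban1983to89.B9Eq39Adjoint (covD covDstar)
open Literature.MathematicalPhysics.QuantumFieldTheory.Balaban1983to89.B9Eq352DivForm (tauB)
open Literature.MathematicalPhysics.QuantumFieldTheory.Balaban1983to89.B9Eq352DivFormLetters (conj)
open Literature.MathematicalPhysics.QuantumFieldTheory.Balaban1983to89.B9Eq352GradLetters (diffLetter)
open Literature.MathematicalPhysics.QuantumFieldTheory.Balaban1983to89.B9Eq360Vprime (gPrimeExtEnd)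
open Literature.MathematicalPhysics.QuantumFieldTheory.Balaban1983to89.B9Eq360VprimeLetters (vPrimeConc)
open Literature.MathematicalPhysics.QuantumFieldTheory.Balaban1983to89.B9Thm34SectBUniformR1 (thm34_Gp_uniform thm34_Cinv_uniform)
open Literature.MathematicalPhysics.QuantumFieldTheory.Balaban1983to89.B9Thm34HolderGpUniformR1 (thm34_Gp_holderLeft_uniform
  thm34_Gp_holderRight_uniform thm34_Gp_holderInput_uniform)
open Literature.MathematicalPhysics.QuantumFieldTheory.Balaban1983to89.B6RandomWalkHom (HasMajorantHom)
open Literature.MathematicalPhysics.QuantumFieldTheory.Balaban1983to89.B9FromB6 (EBlock)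
open Literature.MathematicalPhysics.QuantumFieldTheory.Balaban1983to89.B9SectBStepWhole (StepPos StepEPos StepKerPos StepAnalyticPos1)

universe u

variable {I : Type} (d : ℕ) (c35 : ℝ) (geo : I → B9.Geometry) (bg : I → B9.Backgrounds)
  (Gp : ∀ i, B9.KernelFamily (geo i) (bg i))
  {𝔸 : Type u} [NormedRing 𝔸] [NormedAlgebra ℂ 𝔸] [CompleteSpace 𝔸] {ι : Type} [Fintype ι] [DecidableEq ι]
  (b : Module.Basis ι ℝ 𝔸) (κ : Type) [Fintype κ]
  (S : I → Type) [∀ i, Fintype (S i)] [∀ i, DecidableEq (S i)]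
  [∀ i, Fintype (geo i).Site] [∀ i, DecidableEq (geo i).Site] [∀ i, Nonempty (geo i).Site]

/-- **THE LETTERS DICTIONARY FOR THE G′ FAMILY** — the contract between the abstract family `Gp i : B9.KernelFamily (geo i) (bg i)`
(the readings (3.42) Theorem 3.1 bounds) and the letters of the tree's Sect. B programme at every member `i` of the family:
the fine lattice `S i` with shifts `T i` (p. 390), the block map `blk i` (𝔅, p. 393), the background read as a lattice field
`coord i U : κ → S i → 𝔸ˣ`, the letters `Δp i U` = Δ′_a(U) (3.24), `Gop i U` = G′(U) (3.25), `Lap i U` = Δ_U (the fourth entry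
of (3.42)), the (3.19) block-averaging data `kQ sQ w` and the a-coefficients `cfun` of Δ′_a, the exponent field `expA i U U′`
with U′ = e^{iηA} and its (3.59) data `kF sF`; the FRAME-LEVEL constants (uniform in the member, p. 399 *"the constants … do
not depend on the sequence {Ω_j}"*): `dB` ([4] (2.61)'s dimension), `Cq a₀ d₀ M₂`, the scale-transfer function `Λf` ([4] Lemma
2.1 ∕ p. 398), the reading constant `cR`, the writing functions `wB wδ`, the thresholds `MInv aInv aW`, (v2) the rate cap `δcap` and the
Lemma-2.1 threshold functions `M261 MST`; and the LAWS: the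
geometry axioms, (2.61) and the scale transfers at every rate, unitary-type background and stencil range, the (3.19) ∕ (3.24)
sizes, `gop_eq` ∕ `reg_inv` (G′(U) is the inverse of Δ′_a(U): Thm 3.11 p. 416 under (3.35)), `cplx` (the blockwise reading of
(3.37)), `mul_law` ((3.60)), `read342` ∕ `write342` (the (3.42) entries ARE block majorants of the letters, both ways, *"of
course with different constants"* p. 403).  Field shapes = the hypotheses of `B9Thm34SectBUniformR1.thm34_Gp_uniform`, except that
(v2) the two [4] Lemma-2.1 fields `h261` ∕ `hST` are M-THRESHOLDED (`M261`, `MST`: print's (2.59)) and RATE-CAPPED (`δcap`) — see the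
module header.  A hypothesis structure; nothing asserted.
[cite: Balaban1985BackgroundPropagators, Thm 3.4 p.400 + (3.60)–(3.64) p.402 + p.403 + Thm 3.1 (3.42) p.397 + (3.37) p.396 + (3.24)–(3.25) p.394 + (3.19) p.393 + Thm 3.11 p.416; Balaban1984PropagatorsII, Lemma 2.1 (2.61) p.234 + (2.51) p.232] -/
structure GpFrame₂ where
  /-- [4] (2.61)'s dimension parameter. -/
  dB : ℕ
  /-- (3.59) constant C_q, the a-coefficient bound a₀ of Δ′_a, the stencil range d₀, the real-coordinate constant M₂ of `b`. -/
  Cq : ℝ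
  a₀ : ℝ
  d₀ : ℝ
  M₂ : ℝ
  /-- [4] Lemma 2.1 ∕ p. 398: the scale-transfer constant at rate δ and exponent α. -/
  Λf : ℝ → ℝ → ℝ
  /-- reading constant, writing functions (constant, rate), thresholds (M, Mα₀ for invertibility; α₁ for writing). -/
  cR : ℝ
  wB : ℝ → ℝ → ℝ
  wδ : ℝ → ℝ
  MInv : ℝ
  aInv : ℝ
  aW : ℝ
  /-- (v2) the RATE CAP of the frame and the M-THRESHOLDS of [4] Lemma 2.1 ∕ the p. 398 scale transfer at a given rate
  (print's size condition (2.59) «¼αδ₀RM > 2d log c₀(½α) + 1», read at the smallest exponent 9∕5000 the r06 chain uses). -/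
  δcap : ℝ
  M261 : ℝ → ℝ
  MST : ℝ → ℝ
  /-- (v2.1) the EXPONENT of [4] (2.61)'s printed-shape constant c₁ = 12c₀(½α)^{d} AS A FUNCTION OF THE RATE — decoupled from the (3.48)
  exponent `dB` (the r06 chain is called at `d := d261 δr`; kernel readings are exponent-free, `kerBound_exp_change`). -/
  d261 : ℝ → ℕ
  Cq_nonneg : 0 ≤ Cq
  a₀_nonneg : 0 ≤ a₀
  M₂_nonneg : 0 ≤ M₂
  Λf_one_le : ∀ δ α : ℝ, 0 < δ → 0 < α → 1 ≤ Λf δ α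
  cR_pos : 0 < cR
  wB_pos : ∀ B δ : ℝ, 0 ≤ B → 0 < δ → 0 < wB B δ
  wδ_pos : ∀ δ : ℝ, 0 < δ → 0 < wδ δ
  MInv_pos : 0 < MInv
  aInv_pos : 0 < aInv
  aW_pos : 0 < aW
  δcap_pos : 0 < δcap
  hrepr : ∀ (v : 𝔸) (j : ι), |b.repr v j| ≤ M₂ * ‖v‖
  /-- per member: shifts, block map, [4] (2.1)–(2.2) parameter and hypothesis, background coordinates, letters and data. -/
  T : ∀ i, κ → Equiv.Perm (S i)
  blk : ∀ i, S i → (geo i).Site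
  Rr : I → ℝ
  Hp : I → Prop
  coord : ∀ i, (bg i).Cfg → κ → S i → 𝔸ˣ
  kQ : ∀ i, (bg i).Cfg → (geo i).Site → S i → 𝔸 →L[ℝ] 𝔸
  sQ : ∀ i, (bg i).Cfg → S i → 𝔸 →L[ℝ] 𝔸
  w : ∀ i, (bg i).Cfg → (geo i).Site → ℝ
  cfun : ∀ i, (geo i).Site → ℝ
  expA : ∀ i, (bg i).Cfg → (bg i).Cfg → κ → S i → 𝔸
  kF : ∀ i, (bg i).Cfg → (bg i).Cfg → (geo i).Site → S i → 𝔸 →L[ℝ] 𝔸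
  sF : ∀ i, (bg i).Cfg → (bg i).Cfg → S i → 𝔸 →L[ℝ] 𝔸
  Δp : ∀ i, (bg i).Cfg → Module.End ℝ (S i × ι → ℝ)
  Gop : ∀ i, (bg i).Cfg → Module.End ℝ (S i × ι → ℝ)
  Lap : ∀ i, (bg i).Cfg → Module.End ℝ (S i × ι → ℝ)
  /-- the multiscale geometry axioms ([4] (2.46), (2.54)) and the scales. -/
  dist_nonneg : ∀ i (a a' : (geo i).Site), 0 ≤ (geo i).dist a a'
  triangle : ∀ i, Triangle254 (toB6 (geo i) (Rr i) (Hp i))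
  dist_self : ∀ i (y : (geo i).Site), (geo i).dist y y = 0
  dist_comm : ∀ i (y y' : (geo i).Site), (geo i).dist y y' = (geo i).dist y' y
  len_pos : ∀ i (y : (geo i).Site), 0 < (geo i).len y
  eta_le_len : ∀ i (y : (geo i).Site), (geo i).eta ≤ (geo i).len y
  eta_pos : ∀ i, 0 < (geo i).eta
  /-- (v2.1) [4] Lemma 2.1 (2.61) IN PRINTED SHAPE WITH THE EXPONENT `d261 δ` — at every rate `0 < δ ≦ δcap`, for the exponents
  `9/5000 ≦ α < 1` the r06 chain uses, ABOVE THE M-THRESHOLD `M261 δ` (print's (2.59): «Now we require that RM is sufficiently large»,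
  p. 233; monotone in α, so one threshold per rate serves every α ≥ 9/5000).  The v1 field asked it at a fixed exponent for EVERY
  0 < α < 1 with no threshold — unsatisfiable over a family with unboundedly many scales (LOCATED-4); this shape is supplied at the record
  geometry by name (`B9RWSums347DefiniteFacesWindow.ineq261_fn_geo9Y`) and is the one the R1-restated r06 theorems consume at `d := d261 δr`. -/
  h261 : ∀ i (δ α : ℝ), 0 < δ → δ ≤ δcap → 9 / 5000 ≤ α → α < 1 → M261 δ ≤ (geo i).M →
    Ineq261 (d261 δ) (toB6 (geo i) (Rr i) (Hp i)) δ α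
  /-- (v2) the p. 398 scale transfers («Using Lemma 2.1 in [4] we may replace the factor (Lʲη)^α by (Lʲη)^β(L^{j′}η)^γ») for the six
  weights, at every rate `0 < δ ≦ δcap` and exponent `9/5000 ≦ α`, ABOVE THE M-THRESHOLD `MST δ` ([4] (2.60) + the size condition
  `L^{|γ|}e^{−αδRM} ≦ 1` of `B9Ineq347.scaleTransfer_of_260`). -/
  hST : ∀ i (δ α : ℝ), 0 < δ → δ ≤ δcap → 9 / 5000 ≤ α → MST δ ≤ (geo i).M →
    ScaleTransfer (geo i) δ α (Λf δ α) (fun a => (geo i).len a) ∧ ScaleTransfer (geo i) δ α (Λf δ α) (fun a => (geo i).len a ^ 2) ∧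
    ScaleTransfer (geo i) δ α (Λf δ α) (fun a => ((geo i).len a)⁻¹) ∧
    ScaleTransfer (geo i) δ α (Λf δ α) (fun a => ((geo i).len a ^ 2)⁻¹) ∧
    ScaleTransfer (geo i) δ α (Λf δ α) (fun a => ((geo i).len a ^ 4)⁻¹) ∧
    ScaleTransfer (geo i) δ α (Λf δ α) (fun y => (geo i).len y ^ (-(4 : ℝ)))
  /-- unitary-type background, stencil range `d₀` of the shifts in the multiscale distance. -/
  unitary : ∀ i (U : (bg i).Cfg) (m : κ) (z : S i),
    ‖((coord i U m z : 𝔸ˣ) : 𝔸)‖ ≤ 1 ∧ ‖(((coord i U m z)⁻¹ : 𝔸ˣ) : 𝔸)‖ ≤ 1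
  stencilB : ∀ i (μ : κ) (x : S i), (geo i).dist (blk i x) (blk i ((T i μ).symm x)) ≤ d₀
  stencilF : ∀ i (μ : κ) (x : S i), (geo i).dist (blk i x) (blk i (T i μ x)) ≤ d₀
  stencil0 : ∀ i (y : (geo i).Site), (geo i).dist y y ≤ d₀
  /-- the A-independent (3.19) ∕ (3.24) data of the concrete V′(A) of (3.60). -/
  w_nonneg : ∀ i (U : (bg i).Cfg) (y : (geo i).Site), 0 ≤ w i U y
  card_w : ∀ i (U : (bg i).Cfg) (y : (geo i).Site), ((B9Eq360Vprime.block (blk i) y).card : ℝ) * w i U y ≤ 1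
  hkQ : ∀ i (U : (bg i).Cfg) (y : (geo i).Site) (x : S i), blk i x = y → ‖kQ i U y x‖ ≤ w i U y
  hsQ : ∀ i (U : (bg i).Cfg) (x : S i), ‖sQ i U x‖ ≤ 1
  hcfun : ∀ i (y : (geo i).Site), |cfun i y| ≤ a₀ * ((geo i).len y ^ 2)⁻¹
  /-- `G′(V)` is THE two-sided inverse of `Δ′_a(V)` whenever one exists (every configuration, complex ones included). -/
  gop_eq : ∀ i (V : (bg i).Cfg) (D X : Module.End ℝ (S i × ι → ℝ)), Δp i V = D → D * X = 1 → X * D = 1 → Gop i V = X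
  /-- Theorem 3.11: at a (3.35)-regular U above the thresholds, Δ′_a(U) is invertible (G′(U) inverts it). -/
  reg_inv : ∀ i (α₀ : ℝ) (U : (bg i).Cfg), MInv ≤ (geo i).M → 0 < α₀ → (geo i).M * α₀ ≤ aInv → (bg i).Reg335 c35 α₀ U →
    Δp i U * Gop i U = 1 ∧ Gop i U * Δp i U = 1
  /-- the class (3.37) read blockwise: U′ = e^{iηA}, A = `expA i U U′`, with the seven bounds `thm34_Gp_uniform` consumes. -/
  cplx : ∀ i (α₁ : ℝ) (U U' : (bg i).Cfg), 0 < α₁ → (bg i).Cplx337 α₁ U U' →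
    (∀ (y : (geo i).Site) (x : S i), blk i x = y → ‖kF i U U' y x‖ ≤ Cq * α₁ * w i U y) ∧
    (∀ x : S i, ‖sF i U U' x‖ ≤ Cq * α₁) ∧
    (∀ (ν k : κ) (x : S i), ‖(((geo i).eta : ℂ))⁻¹ • covDstar (T i) (coord i U) ν (expA i U U' k) x‖ ≤
      α₁ * ((geo i).len (blk i x) ^ 2)⁻¹) ∧
    (∀ (μ ν : κ) (x : S i), ‖(((geo i).eta : ℂ))⁻¹ • covD (T i) (coord i U) μ (expA i U U' ν) x‖ ≤
      α₁ * ((geo i).len (blk i x) ^ 2)⁻¹) ∧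
    (∀ (μ : κ) (x : S i), ‖(((geo i).eta : ℂ))⁻¹ • covDstar (T i) (coord i U) μ (tauB (T i) (coord i U) μ (expA i U U' μ)) x‖ ≤
      α₁ * ((geo i).len (blk i x) ^ 2)⁻¹) ∧
    (∀ (k : κ) (x : S i), ‖expA i U U' k x‖ ≤ α₁ * ((geo i).len (blk i x))⁻¹) ∧
    (∀ (ν k : κ) (x : S i), ‖tauB (T i) (coord i U) ν (expA i U U' k) x‖ ≤ α₁ * ((geo i).len (blk i x))⁻¹)
  /-- (3.60): Δ′_a(U′U) = Δ′_a(U) − V′(A) with the concrete V′(A) of the tree's Sect. B programme. -/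
  mul_law : ∀ i (α₁ : ℝ) (U U' : (bg i).Cfg), 0 < α₁ → (bg i).Cplx337 α₁ U U' →
    Δp i ((bg i).mul U' U) = Δp i U -
      conj b (vPrimeConc (T i) (coord i U) (geo i).eta (expA i U U') (blk i) (kQ i U) (kF i U U') (sQ i U) (sF i U U') (cfun i))
  /-- READING: the (3.42) block of K at U with (B₀, δ) ⇒ block majorants of the four letters of G′(U) with (cR·B₀, δ). -/
  read342 : ∀ i (α₀ : ℝ) (U : (bg i).Cfg) (B₀ δ : ℝ), MInv ≤ (geo i).M → 0 < α₀ → (geo i).M * α₀ ≤ aInv →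
    (bg i).Reg335 c35 α₀ U → 0 < B₀ → 0 < δ → EBlock (Gp i) B₀ δ U →
    HasMajorant (g := toB6 (geo i) (Rr i) (Hp i)) (fun p : S i × ι => blk i p.1) (Gop i U)
        (fun a a' => cR * B₀ * (geo i).len a ^ 2 * Real.exp (-(δ * (geo i).dist a a'))) ∧
      (∀ k : κ ⊕ κ, HasMajorant (g := toB6 (geo i) (Rr i) (Hp i)) (fun p : S i × ι => blk i p.1)
        (conj b (diffLetter (T i) (coord i U) ((((geo i).eta : ℂ))⁻¹) k) * Gop i U)
        (fun a a' => cR * B₀ * (geo i).len a * Real.exp (-(δ * (geo i).dist a a')))) ∧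
      (∀ k : κ ⊕ κ, HasMajorant (g := toB6 (geo i) (Rr i) (Hp i)) (fun p : S i × ι => blk i p.1)
        (Gop i U * conj b (diffLetter (T i) (coord i U) ((((geo i).eta : ℂ))⁻¹) k))
        (fun a a' => cR * B₀ * (geo i).len a * Real.exp (-(δ * (geo i).dist a a')))) ∧
      HasMajorant (g := toB6 (geo i) (Rr i) (Hp i)) (fun p : S i × ι => blk i p.1) (Lap i U * Gop i U)
        (fun a a' => cR * B₀ * 1 * Real.exp (-(δ * (geo i).dist a a')))
  /-- WRITING: block majorants of the four letters of G′(U′U) (letters ∇_{U,k}, Δ_U at the real U) with (B, δ) ⇒ the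
  (3.42) block of K at U′U with (wB B δ, wδ δ), for U′ in the class (3.37) at α₁ ≤ aW. -/
  write342 : ∀ i (U U' : (bg i).Cfg) (α₁ B δ : ℝ), 0 < α₁ → α₁ ≤ aW → (bg i).Cplx337 α₁ U U' → 0 ≤ B → 0 < δ →
    HasMajorant (g := toB6 (geo i) (Rr i) (Hp i)) (fun p : S i × ι => blk i p.1) (Gop i ((bg i).mul U' U))
        (fun a a' => B * (geo i).len a ^ 2 * Real.exp (-(δ * (geo i).dist a a'))) →
    (∀ k : κ ⊕ κ, HasMajorant (g := toB6 (geo i) (Rr i) (Hp i)) (fun p : S i × ι => blk i p.1)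
        (conj b (diffLetter (T i) (coord i U) ((((geo i).eta : ℂ))⁻¹) k) * Gop i ((bg i).mul U' U))
        (fun a a' => B * (geo i).len a * Real.exp (-(δ * (geo i).dist a a')))) →
    (∀ k : κ ⊕ κ, HasMajorant (g := toB6 (geo i) (Rr i) (Hp i)) (fun p : S i × ι => blk i p.1)
        (Gop i ((bg i).mul U' U) * conj b (diffLetter (T i) (coord i U) ((((geo i).eta : ℂ))⁻¹) k))
        (fun a a' => B * (geo i).len a * Real.exp (-(δ * (geo i).dist a a')))) →
    HasMajorant (g := toB6 (geo i) (Rr i) (Hp i)) (fun p : S i × ι => blk i p.1) (Lap i U * Gop i ((bg i).mul U' U))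
        (fun a a' => B * 1 * Real.exp (-(δ * (geo i).dist a a'))) →
    EBlock (Gp i) (wB B δ) (wδ δ) ((bg i).mul U' U)

variable {d c35 geo bg Gp b κ S}

/-- Rate bookkeeping for block majorants: a majorant `c·P(a)·e^{−δd}` with `c·P ≧ 0` stays one at any smaller rate `δ′ ≦ δ`
(d ≧ 0). [folklore] [cite: Balaban1984PropagatorsII, (2.51) p.232] -/
private theorem hasMajorant_rate_le {g : B6.Geometry} {X : Type} (blk : X → g.Site) {T : Module.End ℝ (X → ℝ)}
    {c δ δ' : ℝ} (P : g.Site → ℝ) (hc : ∀ a, 0 ≤ c * P a) (hδ : δ' ≤ δ) (hd : ∀ a a' : g.Site, 0 ≤ g.dist a a')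
    (h : HasMajorant blk T (fun a a' => c * P a * Real.exp (-(δ * g.dist a a')))) :
    HasMajorant blk T (fun a a' => c * P a * Real.exp (-(δ' * g.dist a a'))) :=
  hasMajorant_mono blk h fun a a' =>
    mul_le_mul_of_nonneg_left (Real.exp_le_exp.2 (by nlinarith [hd a a', hδ])) (hc a)

/-- The (3.48)-type kernel bound `|T(y,y′)| ≦ c(Lʲη)⁻⁴(L^{j′}η)^{−d}E(y,y′)` w.r.t. the volume pairing `vol g d` ((L^{j′}η)^d, p. 398) is the
SAME inequality on the matrix entries for every exponent `d` — the factor `(L^{j′}η)^{−d}` IS the reciprocal pairing weight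
(`B9Thm34Inv.ker_le_iff`, `vol_inv`): exponent change `d ↦ D`.  This is what lets the steps call the r06 chain at a [4] Lemma-2.1 exponent
`d261 δr` different from the frame's (3.48) exponent `dB`. [cite: Balaban1985BackgroundPropagators, Thm 3.2 (3.48) p.398] -/
theorem kerBound_exp_change {g : B9.Geometry} [Fintype g.Site] [DecidableEq g.Site]
    (hlen : ∀ y : g.Site, 0 < g.len y) (T : Module.End ℝ (g.Site → ℝ)) {c : ℝ} {E : g.Site → g.Site → ℝ} (d D : ℕ)
    (h : ∀ y y' : g.Site, |B9Thm34Inv.ker (B9Thm34Inv.vol g d) T y y'| ≤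
      c * g.len y ^ (-(4 : ℝ)) * g.len y' ^ (-(d : ℝ)) * E y y') :
    ∀ y y' : g.Site, |B9Thm34Inv.ker (B9Thm34Inv.vol g D) T y y'| ≤
      c * g.len y ^ (-(4 : ℝ)) * g.len y' ^ (-(D : ℝ)) * E y y' := by
  intro y y'
  have hv : ∀ n : ℕ, 0 < B9Thm34Inv.vol g n y' := fun n => B9Thm34Inv.vol_pos n hlen y'
  have h1 := h y y'
  rw [← B9Thm34Inv.vol_inv d hlen y', show c * g.len y ^ (-(4 : ℝ)) * (B9Thm34Inv.vol g d y')⁻¹ * E y y' =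
      (c * g.len y ^ (-(4 : ℝ)) * E y y') * (B9Thm34Inv.vol g d y')⁻¹ by ring] at h1
  have key : |B9Thm34Inv.entry T y y'| ≤ c * g.len y ^ (-(4 : ℝ)) * E y y' :=
    (B9Thm34Inv.ker_le_iff _ (hv d) T y _).1 h1
  have h2 := (B9Thm34Inv.ker_le_iff _ (hv D) T y _).2 key
  rw [B9Thm34Inv.vol_inv D hlen y'] at h2
  calc |B9Thm34Inv.ker (B9Thm34Inv.vol g D) T y y'| ≤ (c * g.len y ^ (-(4 : ℝ)) * E y y') * g.len y' ^ (-(D : ℝ)) := h2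
    _ = c * g.len y ^ (-(4 : ℝ)) * g.len y' ^ (-(D : ℝ)) * E y y' := by ring

namespace GpFrame₂

variable (F : GpFrame₂ c35 geo bg Gp b κ S)

/-- The CALL RATE of a step with input rate δ: `min δ δcap` (inputs at rate δ are inputs at any smaller rate; the r06 theorems
are called at the capped rate, where the frame's Lemma-2.1 fields apply). [cite: Balaban1985BackgroundPropagators, p.403 l.5–7 («of course with different constants»)] -/
def rate (δ : ℝ) : ℝ := min δ F.δcap

/-- The M-THRESHOLD of a step calling the r06 chain at rate δ: invertibility (`MInv`), [4] (2.61) (`M261 δ`), scale transfer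
(`MST δ`). [cite: Balaban1985BackgroundPropagators, Thm 3.1 p.397 («for M ≥ M₁»); Balaban1984PropagatorsII, (2.59) p.233] -/
def Mthr (δ : ℝ) : ℝ := max F.MInv (max (F.M261 δ) (F.MST δ))

omit [CompleteSpace 𝔸] [DecidableEq ι] [∀ i, DecidableEq (S i)] [∀ i, Nonempty (geo i).Site] in
/-- `0 < rate δ` for `0 < δ` (the call rate is a positive rate; p. 403 «of course with different constants»).
[cite: Balaban1985BackgroundPropagators, p.403 l.5–7] -/
theorem rate_pos {δ : ℝ} (hδ : 0 < δ) : 0 < F.rate δ := lt_min hδ F.δcap_pos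

omit [CompleteSpace 𝔸] [DecidableEq ι] [∀ i, DecidableEq (S i)] [∀ i, Nonempty (geo i).Site] in
/-- `rate δ ≦ δ`: inputs at the rate δ are inputs at the call rate (p. 403 «of course with different constants»).
[cite: Balaban1985BackgroundPropagators, p.403 l.5–7] -/
theorem rate_le (δ : ℝ) : F.rate δ ≤ δ := min_le_left _ _

omit [CompleteSpace 𝔸] [DecidableEq ι] [∀ i, DecidableEq (S i)] [∀ i, Nonempty (geo i).Site] in
/-- `rate δ ≦ δcap`: the call rate lies in the window where the frame's [4] Lemma-2.1 fields apply.
[cite: Balaban1984PropagatorsII, Lemma 2.1 p.234 + (2.59) p.233] -/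
theorem rate_le_cap (δ : ℝ) : F.rate δ ≤ F.δcap := min_le_right _ _

omit [CompleteSpace 𝔸] [DecidableEq ι] [∀ i, DecidableEq (S i)] [∀ i, Nonempty (geo i).Site] in
/-- `0 < Mthr δ` (Theorem 3.1's «positive constants M₁ …», p. 397).
[cite: Balaban1985BackgroundPropagators, Thm 3.1 p.397] -/
theorem Mthr_pos (δ : ℝ) : 0 < F.Mthr δ := lt_max_of_lt_left F.MInv_pos

omit [CompleteSpace 𝔸] [DecidableEq ι] [∀ i, DecidableEq (S i)] [∀ i, Nonempty (geo i).Site] in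
/-- `MInv ≦ M` above the step's threshold («for M ≥ M₁», Theorem 3.1 p. 397; Thm 3.11 p. 416 invertibility).
[cite: Balaban1985BackgroundPropagators, Thm 3.1 p.397 + Thm 3.11 p.416] -/
theorem MInv_le_of_Mthr_le {δ M : ℝ} (h : F.Mthr δ ≤ M) : F.MInv ≤ M := le_trans (le_max_left _ _) h

omit [CompleteSpace 𝔸] [DecidableEq ι] [∀ i, DecidableEq (S i)] [∀ i, Nonempty (geo i).Site] in
/-- `M261 δ ≦ M` above the step's threshold: print's (2.59) «RM sufficiently large» at the call rate.
[cite: Balaban1984PropagatorsII, (2.59) p.233 + Lemma 2.1 p.234] -/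
theorem M261_le_of_Mthr_le {δ M : ℝ} (h : F.Mthr δ ≤ M) : F.M261 δ ≤ M :=
  le_trans (le_trans (le_max_left _ _) (le_max_right _ _)) h

omit [CompleteSpace 𝔸] [DecidableEq ι] [∀ i, DecidableEq (S i)] [∀ i, Nonempty (geo i).Site] in
/-- `MST δ ≦ M` above the step's threshold: the size condition of the p. 398 scale transfer ([4] (2.60)) at the call rate.
[cite: Balaban1985BackgroundPropagators, p.398 remark after (3.47); Balaban1984PropagatorsII, Lemma 2.1 (2.60) p.234] -/
theorem MST_le_of_Mthr_le {δ M : ℝ} (h : F.Mthr δ ≤ M) : F.MST δ ≤ M :=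
  le_trans (le_trans (le_max_right _ _) (le_max_right _ _)) h

omit [CompleteSpace 𝔸] [DecidableEq ι] [∀ i, DecidableEq (S i)] [∀ i, Nonempty (geo i).Site] in
/-- [4] (2.61) at a capped rate above the threshold, in the shape the r06 chain (R1) consumes: `∀ α, 9/5000 ≦ α → α < 1 → Ineq261 …`.
[cite: Balaban1984PropagatorsII, Lemma 2.1 (2.61) p.234 + (2.59) p.233] -/
theorem h261_of (i : I) {δr : ℝ} (hδr : 0 < δr) (hc : δr ≤ F.δcap) (hM : F.Mthr δr ≤ (geo i).M) :
    ∀ α : ℝ, 9 / 5000 ≤ α → α < 1 → Ineq261 (F.d261 δr) (toB6 (geo i) (F.Rr i) (F.Hp i)) δr α :=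
  fun α hα hα1 => F.h261 i δr α hδr hc hα hα1 (F.M261_le_of_Mthr_le hM)

omit [CompleteSpace 𝔸] [DecidableEq ι] [∀ i, DecidableEq (S i)] [∀ i, Nonempty (geo i).Site] in
/-- The six scale transfers at a capped rate above the threshold, in the shape the r06 chain (R1) consumes.
[cite: Balaban1985BackgroundPropagators, p.398 remark after (3.47); Balaban1984PropagatorsII, Lemma 2.1 (2.60) p.234] -/
theorem hST_of (i : I) {δr : ℝ} (hδr : 0 < δr) (hc : δr ≤ F.δcap) (hM : F.Mthr δr ≤ (geo i).M) :
    ∀ α : ℝ, 9 / 5000 ≤ α →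
      ScaleTransfer (geo i) δr α (F.Λf δr α) (fun a => (geo i).len a) ∧
      ScaleTransfer (geo i) δr α (F.Λf δr α) (fun a => (geo i).len a ^ 2) ∧
      ScaleTransfer (geo i) δr α (F.Λf δr α) (fun a => ((geo i).len a)⁻¹) ∧
      ScaleTransfer (geo i) δr α (F.Λf δr α) (fun a => ((geo i).len a ^ 2)⁻¹) ∧
      ScaleTransfer (geo i) δr α (F.Λf δr α) (fun a => ((geo i).len a ^ 4)⁻¹) ∧
      ScaleTransfer (geo i) δr α (F.Λf δr α) (fun y => (geo i).len y ^ (-(4 : ℝ))) :=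
  fun α hα => F.hST i δr α hδr hc hα (F.MST_le_of_Mthr_le hM)

omit [CompleteSpace 𝔸] [DecidableEq ι] [∀ i, DecidableEq (S i)] [∀ i, Nonempty (geo i).Site] in
set_option maxHeartbeats 800000 in
/-- READING (3.42) AT A LOWER RATE: the four letters of G′(U) carry the read majorants at every rate `δ′ ≦ δ`.
[cite: Balaban1985BackgroundPropagators, Thm 3.1 (3.42) p.397; Balaban1984PropagatorsII, (2.51) p.232] -/
theorem read342_le (i : I) (α₀ : ℝ) (U : (bg i).Cfg) {B₀ δ δ' : ℝ} (hM : F.MInv ≤ (geo i).M) (hα₀ : 0 < α₀)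
    (hMa : (geo i).M * α₀ ≤ F.aInv) (hU : (bg i).Reg335 c35 α₀ U) (hB₀ : 0 < B₀) (hδ : 0 < δ) (hle : δ' ≤ δ)
    (hE : EBlock (Gp i) B₀ δ U) :
    HasMajorant (g := toB6 (geo i) (F.Rr i) (F.Hp i)) (fun p : S i × ι => F.blk i p.1) (F.Gop i U)
        (fun a a' => F.cR * B₀ * (geo i).len a ^ 2 * Real.exp (-(δ' * (geo i).dist a a'))) ∧
      (∀ k : κ ⊕ κ, HasMajorant (g := toB6 (geo i) (F.Rr i) (F.Hp i)) (fun p : S i × ι => F.blk i p.1)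
        (conj b (diffLetter (F.T i) (F.coord i U) ((((geo i).eta : ℂ))⁻¹) k) * F.Gop i U)
        (fun a a' => F.cR * B₀ * (geo i).len a * Real.exp (-(δ' * (geo i).dist a a')))) ∧
      (∀ k : κ ⊕ κ, HasMajorant (g := toB6 (geo i) (F.Rr i) (F.Hp i)) (fun p : S i × ι => F.blk i p.1)
        (F.Gop i U * conj b (diffLetter (F.T i) (F.coord i U) ((((geo i).eta : ℂ))⁻¹) k))
        (fun a a' => F.cR * B₀ * (geo i).len a * Real.exp (-(δ' * (geo i).dist a a')))) ∧
      HasMajorant (g := toB6 (geo i) (F.Rr i) (F.Hp i)) (fun p : S i × ι => F.blk i p.1) (F.Lap i U * F.Gop i U)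
        (fun a a' => F.cR * B₀ * 1 * Real.exp (-(δ' * (geo i).dist a a'))) := by
  obtain ⟨h1, h2, h3, hL⟩ := F.read342 i α₀ U B₀ δ hM hα₀ hMa hU hB₀ hδ hE
  have hBG : 0 < F.cR * B₀ := mul_pos F.cR_pos hB₀
  have hc2 : ∀ a : (geo i).Site, 0 ≤ F.cR * B₀ * (geo i).len a ^ 2 := fun a => mul_nonneg hBG.le (sq_nonneg _)
  have hc1 : ∀ a : (geo i).Site, 0 ≤ F.cR * B₀ * (geo i).len a := fun a => mul_nonneg hBG.le (F.len_pos i a).le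
  have hc0 : ∀ _a : (geo i).Site, 0 ≤ F.cR * B₀ * 1 := fun _ => by rw [mul_one]; exact hBG.le
  refine ⟨?_, fun k => ?_, fun k => ?_, ?_⟩
  · exact hasMajorant_rate_le (g := toB6 (geo i) (F.Rr i) (F.Hp i)) (fun p : S i × ι => F.blk i p.1)
      (fun a => (geo i).len a ^ 2) hc2 hle (F.dist_nonneg i) h1
  · exact hasMajorant_rate_le (g := toB6 (geo i) (F.Rr i) (F.Hp i)) (fun p : S i × ι => F.blk i p.1)
      (fun a => (geo i).len a) hc1 hle (F.dist_nonneg i) (h2 k)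
  · exact hasMajorant_rate_le (g := toB6 (geo i) (F.Rr i) (F.Hp i)) (fun p : S i × ι => F.blk i p.1)
      (fun a => (geo i).len a) hc1 hle (F.dist_nonneg i) (h3 k)
  · exact hasMajorant_rate_le (g := toB6 (geo i) (F.Rr i) (F.Hp i)) (fun p : S i × ι => F.blk i p.1)
      (fun _ => (1 : ℝ)) hc0 hle (F.dist_nonneg i) hL

end GpFrame₂

/-- ★ **THE (3.42)-STEP OF SECT. B FOR G′(U′U), INHABITED AT THE LETTERS**: every letters dictionary `GpFrame₂` for the family
`Gp` inhabits the positive-input block-step `B9SectBStepWhole.StepEPos d c35 geo bg Gp GA Cinv Gp` (for any companion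
families `GA`, `Cinv` of the leaf).  Proof = r06's `B9Thm34SectBUniformR1.thm34_Gp_uniform` at the CALL RATE δr = `rate δ₀` =
min(δ₀, δcap) and sup constant cR·B₀ (its `a₁`, `B` are chosen BEFORE the member — the step's constants are uniform in `i`), the uniqueness of
two-sided inverses (the family's `G′(U′U)` inverts `Δ′_a(U′U) = Δ′_a(U) − V′(A)` (3.60), as does r06's extension
`gPrimeExtEnd G′(U) (V′(A)G′(U))` of (3.64) — so they coincide, `gop_eq`), and the frame's readings (3.42) ↔ block
majorants (lowered to δr).  Thresholds: M ≧ Mthr δr (invertibility, (2.59), scale transfer), Mα₀ ≦ aInv, α₁ ≦ min(a₁, aW); output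
constants (wB B (9δr/10), wδ (9δr/10)).  Nothing of print asserted beyond what `thm34_Gp_uniform` proves.
[cite: Balaban1985BackgroundPropagators, Thm 3.4 p.400 + (3.60)–(3.65) p.402 + p.403 + Thm 3.1 (3.42) p.397 + Thm 3.11 p.416; Balaban1984PropagatorsII, Lemma 2.1 p.234] -/
theorem stepEPos_of_gpFrame₂ (F : GpFrame₂ c35 geo bg Gp b κ S)
    (GA : ∀ i, B9.KernelFamily (geo i) (bg i)) (Cinv : ∀ i, B9.SiteKernel (geo i) (bg i)) :
    StepEPos d c35 geo bg Gp GA Cinv Gp := by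
  intro B₀ δ₀ Bβ Bε Bεβ B₁ δ₁ hB₀ hδ₀ _ _
  -- r06's uniform Theorem-3.4 clause for G′ (R1), at the CALL RATE δr = min δ₀ δcap and the read sup constant cR·B₀
  have hδr : 0 < F.rate δ₀ := F.rate_pos hδ₀
  obtain ⟨a₁, ha₁, B, hB, H⟩ := thm34_Gp_uniform b κ (F.d261 (F.rate δ₀)) (F.rate δ₀) (F.cR * B₀) F.Cq F.a₀ F.d₀ F.M₂ (F.Λf (F.rate δ₀))
    (mul_pos F.cR_pos hB₀) F.Cq_nonneg F.a₀_nonneg F.M₂_nonneg hδr (fun α hα => F.Λf_one_le _ α hδr hα) F.hrepr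
  have hδ' : 0 < 9 / 10 * F.rate δ₀ := by positivity
  refine ⟨F.Mthr (F.rate δ₀), min a₁ F.aW, F.aInv, (F.wB B (9 / 10 * F.rate δ₀), F.wδ (9 / 10 * F.rate δ₀)), F.Mthr_pos _,
    lt_min ha₁ F.aW_pos, F.aInv_pos, ⟨F.wB_pos B _ hB hδ', F.wδ_pos _ hδ'⟩, ?_⟩
  intro i hM0 α₀ hα₀ hMa U hU hT α₁ hα₁ ha U' hU'
  have hM : F.MInv ≤ (geo i).M := F.MInv_le_of_Mthr_le hM0
  -- G′(U) inverts Δ′_a(U); the (3.42) entries of G′(U) read as block majorants AT THE CALL RATE; (3.37) read blockwise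
  obtain ⟨hΔG, hGΔ⟩ := F.reg_inv i α₀ U hM hα₀ hMa hU
  obtain ⟨h1, h2, h3, hL⟩ := F.read342_le i α₀ U hM hα₀ hMa hU hB₀ hδ₀ (F.rate_le δ₀) hT.1.1.1
  obtain ⟨hkF, hsF, h337s, h337F, h337B, hA, hAτ⟩ := F.cplx i α₁ U U' hα₁ hU'
  obtain ⟨hinv1, hinv2, hleft, hright⟩ := H (F.T i) (F.coord i U) (F.blk i) (F.kQ i U) (F.sQ i U) (F.cfun i) (F.w i U)
    (F.dist_nonneg i) (F.triangle i) (F.dist_self i) (F.dist_comm i) (F.len_pos i) (F.eta_le_len i) (F.eta_pos i)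
    (F.h261_of i hδr (F.rate_le_cap δ₀) hM0) (F.hST_of i hδr (F.rate_le_cap δ₀) hM0) (F.unitary i U)
    (F.stencilB i) (F.stencilF i) (F.stencil0 i) (F.w_nonneg i U) (F.card_w i U) (F.hkQ i U) (F.hsQ i U) (F.hcfun i)
    hΔG hGΔ h1 h2 h3 α₁ hα₁.le (le_trans ha (min_le_left _ _)) (F.expA i U U') (F.kF i U U') (F.sF i U U')
    hkF hsF h337s h337F h337B hA hAτ
  -- the family's G′(U′U) IS r06's extension (3.64): both are two-sided inverses of Δ′_a(U) − V′(A) = Δ′_a(U′U) (3.60)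
  have hG := F.gop_eq i ((bg i).mul U' U) _ _ (F.mul_law i α₁ U U' hα₁ hU') hinv1 hinv2
  rw [← hG] at hleft hright
  -- the four entries of G′(U′U) at (B, 9δr/10), written back as the (3.42) block of the family at U′U
  have e0 : HasMajorant (g := toB6 (geo i) (F.Rr i) (F.Hp i)) (fun p : S i × ι => F.blk i p.1)
      (1 * F.Gop i ((bg i).mul U' U))
      (fun a a' => B * (geo i).len a ^ 2 * Real.exp (-(9 / 10 * F.rate δ₀ * (geo i).dist a a'))) :=
    hleft 1 (fun a => (geo i).len a ^ 2) (fun a => sq_nonneg _) (by simpa only [one_mul] using h1)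
  rw [one_mul] at e0
  exact F.write342 i U U' α₁ B (9 / 10 * F.rate δ₀) hα₁ (le_trans ha (min_le_right _ _)) hU' hB hδ' e0
    (fun k => hleft _ (fun a => (geo i).len a) (fun a => (F.len_pos i a).le) (h2 k))
    (fun k => hright _ (h3 k)) (hleft _ (fun _ => (1 : ℝ)) (fun _ => zero_le_one) hL)

/-! ## The C⁻¹ = (Q′G′²Q′*)⁻¹ clause: (3.65)–(3.67) p. 403 *"The inverse satisfies Theorem 3.2"* — the (3.48)-step at the letters -/

variable (d c35 geo bg Gp b κ S) in
/-- **THE LETTERS DICTIONARY FOR THE PAIR (G′, C⁻¹)** — `GpFrame₂` extended by the (3.19) letters Q′(U), Q′*(U) as Hom letters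
between the fine lattice and 𝔅 (`Qc`, `Qcs`, block-local majorants κ_Q, [4] (2.51)), the letter `Cop i V` = C⁻¹(V) =
(Q′(V)G′(V)²Q′*(V))⁻¹ (3.21) as an operator on 𝔅-functions with its laws `cop_eq` (it is THE two-sided inverse whenever one
exists) and `reg_cinv` ((3.21) exists at (3.35)-regular U above the thresholds, Thm 3.2 ∕ 3.11), the (3.57) law `q_mul`:
Q′(U′U) = Q′(U) + F′(A), Q′*(U′U) = Q′*(U) + F′*(A) with the (3.59) majorants c_F·α₁ (`hF`), and the kernel readings of the
family `Cinv i` against `B9Thm34Inv.ker (vol g dB)` both ways (`readKer` ∕ `writeKer`, kernel reading constant `cK`, writing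
functions `wK`, `wKδ`).  Field shapes = the hypotheses of `B9Thm34SectBUniformR1.thm34_Cinv_uniform` verbatim.  A hypothesis
structure; nothing asserted. [cite: Balaban1985BackgroundPropagators, Thm 3.2 (3.48) p.398 + (3.19)–(3.21) pp.393–394 + (3.57)–(3.59) p.402 + (3.65)–(3.67) p.403 + Thm 3.11 p.416; Balaban1984PropagatorsII, (2.51) p.232] -/
structure CinvFrame₂ (Cinv : ∀ i, B9.SiteKernel (geo i) (bg i)) extends GpFrame₂ c35 geo bg Gp b κ S where
  κQ : ℝ
  cF : ℝ
  cK : ℝ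
  wK : ℝ → ℝ → ℝ
  wKδ : ℝ → ℝ
  κQ_pos : 0 < κQ
  cF_pos : 0 < cF
  cK_pos : 0 < cK
  wK_pos : ∀ B δ : ℝ, 0 ≤ B → 0 < δ → 0 < wK B δ
  wKδ_pos : ∀ δ : ℝ, 0 < δ → 0 < wKδ δ
  Qc : ∀ i, (bg i).Cfg → (S i × ι → ℝ) →ₗ[ℝ] ((geo i).Site → ℝ)
  Qcs : ∀ i, (bg i).Cfg → ((geo i).Site → ℝ) →ₗ[ℝ] (S i × ι → ℝ)
  Cop : ∀ i, (bg i).Cfg → Module.End ℝ ((geo i).Site → ℝ)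
  Fc : ∀ i, (bg i).Cfg → (bg i).Cfg → (S i × ι → ℝ) →ₗ[ℝ] ((geo i).Site → ℝ)
  Fcs : ∀ i, (bg i).Cfg → (bg i).Cfg → ((geo i).Site → ℝ) →ₗ[ℝ] (S i × ι → ℝ)
  /-- (3.19): Q′(U), Q′*(U) are block-local with entries ≦ κ_Q. -/
  hQc : ∀ i (U : (bg i).Cfg), HasMajorantHom (g := toB6 (geo i) (Rr i) (Hp i)) (fun p : S i × ι => blk i p.1)
    (fun y : (geo i).Site => y) (Qc i U) (fun a a' : (geo i).Site => κQ * (if a = a' then (1 : ℝ) else 0))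
  hQcs : ∀ i (U : (bg i).Cfg), HasMajorantHom (g := toB6 (geo i) (Rr i) (Hp i)) (fun y : (geo i).Site => y)
    (fun p : S i × ι => blk i p.1) (Qcs i U) (fun a a' : (geo i).Site => κQ * (if a = a' then (1 : ℝ) else 0))
  /-- `C⁻¹(V)` is THE two-sided inverse of `Q′(V)G′(V)²Q′*(V)` whenever one exists (every configuration). -/
  cop_eq : ∀ i (V : (bg i).Cfg) (D X : Module.End ℝ ((geo i).Site → ℝ)),
    Qc i V ∘ₗ (Gop i V * Gop i V) ∘ₗ Qcs i V = D → X * D = 1 → D * X = 1 → Cop i V = X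
  /-- (3.21) at a (3.35)-regular U above the thresholds: C(U)·C⁻¹(U) = 1 (Thm 3.2 ∕ 3.11). -/
  reg_cinv : ∀ i (α₀ : ℝ) (U : (bg i).Cfg), MInv ≤ (geo i).M → 0 < α₀ → (geo i).M * α₀ ≤ aInv → (bg i).Reg335 c35 α₀ U →
    (Qc i U ∘ₗ (Gop i U * Gop i U) ∘ₗ Qcs i U) * Cop i U = 1
  /-- (3.57): Q′(U′U) = Q′(U) + F′(A), Q′*(U′U) = Q′*(U) + F′*(A) on the class (3.37). -/
  q_mul : ∀ i (α₁ : ℝ) (U U' : (bg i).Cfg), 0 < α₁ → (bg i).Cplx337 α₁ U U' →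
    Qc i ((bg i).mul U' U) = Qc i U + Fc i U U' ∧ Qcs i ((bg i).mul U' U) = Qcs i U + Fcs i U U'
  /-- (3.59): the variations F′(A), F′*(A) are block-local with entries ≦ c_F·α₁. -/
  hF : ∀ i (α₁ : ℝ) (U U' : (bg i).Cfg), 0 < α₁ → (bg i).Cplx337 α₁ U U' →
    HasMajorantHom (g := toB6 (geo i) (Rr i) (Hp i)) (fun p : S i × ι => blk i p.1) (fun y : (geo i).Site => y) (Fc i U U')
        (fun a a' : (geo i).Site => cF * α₁ * (if a = a' then (1 : ℝ) else 0)) ∧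
      HasMajorantHom (g := toB6 (geo i) (Rr i) (Hp i)) (fun y : (geo i).Site => y) (fun p : S i × ι => blk i p.1) (Fcs i U U')
        (fun a a' : (geo i).Site => cF * α₁ * (if a = a' then (1 : ℝ) else 0))
  /-- READING (3.48): the kernel bound of `Cinv i` at U with (B₁, δ) ⇒ the kernel bound of the letter C⁻¹(U) with (cK·B₁, δ). -/
  readKer : ∀ i (α₀ : ℝ) (U : (bg i).Cfg) (B₁ δ : ℝ), MInv ≤ (geo i).M → 0 < α₀ → (geo i).M * α₀ ≤ aInv →
    (bg i).Reg335 c35 α₀ U → 0 < B₁ → 0 < δ →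
    (∀ y y' : (geo i).Site, |(Cinv i).ker U y y'| ≤
      B₁ * ((geo i).len y) ^ (-(4 : ℝ)) * ((geo i).len y') ^ (-(dB : ℝ)) * Real.exp (-(δ * (geo i).dist y y'))) →
    ∀ y y' : (geo i).Site, |B9Thm34Inv.ker (B9Thm34Inv.vol (geo i) dB) (Cop i U) y y'| ≤
      cK * B₁ * (geo i).len y ^ (-(4 : ℝ)) * (geo i).len y' ^ (-(dB : ℝ)) * Real.exp (-(δ * (geo i).dist y y'))
  /-- WRITING (3.48): the kernel bound of C⁻¹(U′U) with (B, δ) ⇒ that of `Cinv i` at U′U with (wK B δ, wKδ δ), U′ in (3.37) at α₁ ≦ aW. -/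
  writeKer : ∀ i (U U' : (bg i).Cfg) (α₁ B δ : ℝ), 0 < α₁ → α₁ ≤ aW → (bg i).Cplx337 α₁ U U' → 0 ≤ B → 0 < δ →
    (∀ y y' : (geo i).Site, |B9Thm34Inv.ker (B9Thm34Inv.vol (geo i) dB) (Cop i ((bg i).mul U' U)) y y'| ≤
      B * (geo i).len y ^ (-(4 : ℝ)) * (geo i).len y' ^ (-(dB : ℝ)) * Real.exp (-(δ * (geo i).dist y y'))) →
    ∀ y y' : (geo i).Site, |(Cinv i).ker ((bg i).mul U' U) y y'| ≤
      wK B δ * ((geo i).len y) ^ (-(4 : ℝ)) * ((geo i).len y') ^ (-(dB : ℝ)) * Real.exp (-(wKδ δ * (geo i).dist y y'))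

/-- ★ **THE (3.48)-STEP OF SECT. B FOR C⁻¹(U′U), INHABITED AT THE LETTERS** ((3.65)–(3.67) p. 403: *"The inverse satisfies
Theorem 3.2"*): every letters dictionary `CinvFrame₂` for the pair (Gp, Cinv) inhabits the positive-input kernel step
`B9SectBStepWhole.StepKerPos F.dB c35 geo bg Gp GA Cinv Cinv` (kernel exponent = the frame's dimension `dB`).  Proof = r06's
`thm34_Cinv_uniform` (R1) at the call rate δ = `rate (min δ₀ δ₁)` of the input tuple (G′ letters read at δ₀, the kernel at δ₁, both lowered),
`thm34_Gp_uniform` for the two-sided inverse identities of the extension, uniqueness twice (`gop_eq`: the family's G′(U′U) is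
r06's extension; `cop_eq`: the family's C⁻¹(U′U) is r06's inverse `Tinv` of Q′(U′U)G′(U′U)²Q′*(U′U), since
Q′(U′U) = Q′(U) + F′(A) by `q_mul`), and the kernel readings.  Thresholds: M ≧ MInv, Mα₀ ≦ aInv, α₁ ≦ min(a₁, a₁′, aW); output
(wK B′ (9δ/25), wKδ (9δ/25)) with B′ = 2·cK·B₁·c₁(2δ/5, 1/10); threshold M ≧ Mthr δ.  Nothing of print asserted beyond what
r06's two theorems prove. [cite: Balaban1985BackgroundPropagators, Thm 3.4 p.400 + (3.65)–(3.67) p.403 + Thm 3.2 (3.48) p.398 + (3.57)–(3.60) p.402 + Thm 3.11 p.416; Balaban1984PropagatorsII, Lemma 2.1 (2.61) p.234] -/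
theorem stepKerPos_of_cinvFrame₂ {Cinv : ∀ i, B9.SiteKernel (geo i) (bg i)} (F : CinvFrame₂ c35 geo bg Gp b κ S Cinv)
    (GA : ∀ i, B9.KernelFamily (geo i) (bg i)) :
    StepKerPos F.dB c35 geo bg Gp GA Cinv Cinv := by
  intro B₀ δ₀ Bβ Bε Bεβ B₁ δ₁ hB₀ hδ₀ hB₁ hδ₁
  -- the CALL RATE δr := min (min δ₀ δ₁) δcap
  have hδm : 0 < min δ₀ δ₁ := lt_min hδ₀ hδ₁
  have hδ : 0 < F.rate (min δ₀ δ₁) := F.rate_pos hδm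
  have hδc : F.rate (min δ₀ δ₁) ≤ F.δcap := F.rate_le_cap _
  have hδ0 : F.rate (min δ₀ δ₁) ≤ δ₀ := le_trans (F.rate_le _) (min_le_left _ _)
  have hδ1 : F.rate (min δ₀ δ₁) ≤ δ₁ := le_trans (F.rate_le _) (min_le_right _ _)
  -- r06's uniform clauses (R1) at the call rate: G′ (for the inverse identities) and C⁻¹
  obtain ⟨a₁, ha₁, B, -, H⟩ := thm34_Gp_uniform b κ (F.d261 (F.rate (min δ₀ δ₁))) (F.rate (min δ₀ δ₁)) (F.cR * B₀) F.Cq F.a₀ F.d₀ F.M₂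
    (F.Λf (F.rate (min δ₀ δ₁))) (mul_pos F.cR_pos hB₀) F.Cq_nonneg F.a₀_nonneg F.M₂_nonneg hδ
    (fun α hα => F.Λf_one_le _ α hδ hα) F.hrepr
  obtain ⟨a₂, ha₂, H'⟩ := thm34_Cinv_uniform b κ (F.d261 (F.rate (min δ₀ δ₁))) (F.rate (min δ₀ δ₁)) F.κQ (F.cR * B₀) (F.cK * B₁) F.cF F.Cq F.a₀
    F.d₀ F.M₂ (F.Λf (F.rate (min δ₀ δ₁))) F.κQ_pos (mul_pos F.cR_pos hB₀) (mul_pos F.cK_pos hB₁) F.cF_pos F.Cq_nonneg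
    F.a₀_nonneg F.M₂_nonneg hδ (fun α hα => F.Λf_one_le _ α hδ hα) F.hrepr
  have hδ' : 0 < 9 / 25 * F.rate (min δ₀ δ₁) := by positivity
  have hB' : 0 ≤ 2 * (F.cK * B₁) * B6.c1 (F.d261 (F.rate (min δ₀ δ₁))) (2 / 5 * F.rate (min δ₀ δ₁)) (1 / 10) :=
    mul_nonneg (mul_nonneg zero_le_two (mul_pos F.cK_pos hB₁).le) (B6RandomWalk.c1_nonneg _ _ _)
  refine ⟨F.Mthr (F.rate (min δ₀ δ₁)), min (min a₁ a₂) F.aW, F.aInv,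
    (F.wK (2 * (F.cK * B₁) * B6.c1 (F.d261 (F.rate (min δ₀ δ₁))) (2 / 5 * F.rate (min δ₀ δ₁)) (1 / 10)) (9 / 25 * F.rate (min δ₀ δ₁)),
      F.wKδ (9 / 25 * F.rate (min δ₀ δ₁))),
    F.Mthr_pos _, lt_min (lt_min ha₁ ha₂) F.aW_pos, F.aInv_pos, ⟨F.wK_pos _ _ hB' hδ', F.wKδ_pos _ hδ'⟩, ?_⟩
  intro i hM0 α₀ hα₀ hMa U hU hT α₁ hα₁ ha U' hU'
  have hM : F.MInv ≤ (geo i).M := F.MInv_le_of_Mthr_le hM0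
  have ha1 : α₁ ≤ a₁ := le_trans ha (le_trans (min_le_left _ _) (min_le_left _ _))
  have ha2 : α₁ ≤ a₂ := le_trans ha (le_trans (min_le_left _ _) (min_le_right _ _))
  have haW : α₁ ≤ F.aW := le_trans ha (min_le_right _ _)
  -- the letters at U: G′(U) inverts Δ′_a(U); (3.42)₀,₁,₂ at δ₀ lowered to the call rate; the kernel (3.48) at δ₁ lowered likewise
  obtain ⟨hΔG, hGΔ⟩ := F.reg_inv i α₀ U hM hα₀ hMa hU
  obtain ⟨h1', h2', h3', -⟩ := F.read342_le i α₀ U hM hα₀ hMa hU hB₀ hδ₀ hδ0 hT.1.1.1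
  have hK := F.readKer i α₀ U B₁ δ₁ hM hα₀ hMa hU hB₁ hδ₁ hT.2.1
  have hK' : ∀ y y' : (geo i).Site, |B9Thm34Inv.ker (B9Thm34Inv.vol (geo i) F.dB) (F.Cop i U) y y'| ≤
      F.cK * B₁ * (geo i).len y ^ (-(4 : ℝ)) * (geo i).len y' ^ (-(F.dB : ℝ)) *
        Real.exp (-(F.rate (min δ₀ δ₁) * (geo i).dist y y')) := by
    intro y y'
    refine (hK y y').trans (mul_le_mul_of_nonneg_left (Real.exp_le_exp.2 ?_) ?_)
    · nlinarith [F.dist_nonneg i y y', hδ1]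
    · exact mul_nonneg (mul_nonneg (mul_pos F.cK_pos hB₁).le (Real.rpow_nonneg (F.len_pos i y).le _))
        (Real.rpow_nonneg (F.len_pos i y').le _)
  -- (v2.1) the Lemma-2.1 exponent of the call is `d261 δr`: move the (exponent-free) kernel reading to it
  have hK'' := kerBound_exp_change (F.len_pos i) (F.Cop i U) F.dB (F.d261 (F.rate (min δ₀ δ₁))) hK'
  obtain ⟨hkF, hsF, h337s, h337F, h337B, hA, hAτ⟩ := F.cplx i α₁ U U' hα₁ hU'
  obtain ⟨hQm, hQsm⟩ := F.q_mul i α₁ U U' hα₁ hU'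
  obtain ⟨hFc, hFcs⟩ := F.hF i α₁ U U' hα₁ hU'
  -- the G′ clause: the inverse identities of the extension ⇒ the family's G′(U′U) is r06's extension
  obtain ⟨hinv1, hinv2, -, -⟩ := H (F.T i) (F.coord i U) (F.blk i) (F.kQ i U) (F.sQ i U) (F.cfun i) (F.w i U)
    (F.dist_nonneg i) (F.triangle i) (F.dist_self i) (F.dist_comm i) (F.len_pos i) (F.eta_le_len i) (F.eta_pos i)
    (F.h261_of i hδ hδc hM0) (F.hST_of i hδ hδc hM0) (F.unitary i U)
    (F.stencilB i) (F.stencilF i) (F.stencil0 i) (F.w_nonneg i U) (F.card_w i U) (F.hkQ i U) (F.hsQ i U) (F.hcfun i)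
    hΔG hGΔ h1' h2' h3' α₁ hα₁.le ha1 (F.expA i U U') (F.kF i U U') (F.sF i U U')
    hkF hsF h337s h337F h337B hA hAτ
  have hG := F.gop_eq i ((bg i).mul U' U) _ _ (F.mul_law i α₁ U U' hα₁ hU') hinv1 hinv2
  -- the C⁻¹ clause: r06's inverse of Q′(U′U)G′(U′U)²Q′*(U′U) with its kernel bound
  obtain ⟨Tinv, hT1, hT2, hker⟩ := H' (F.T i) (F.coord i U) (F.blk i) (F.kQ i U) (F.sQ i U) (F.cfun i) (F.w i U)
    (F.dist_nonneg i) (F.triangle i) (F.dist_self i) (F.dist_comm i) (F.len_pos i) (F.eta_le_len i) (F.eta_pos i)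
    (F.h261_of i hδ hδc hM0) (F.hST_of i hδ hδc hM0) (F.unitary i U)
    (F.stencilB i) (F.stencilF i) (F.stencil0 i) (F.w_nonneg i U) (F.card_w i U) (F.hkQ i U) (F.hsQ i U) (F.hcfun i)
    h1' h2' (F.hQc i U) (F.hQcs i U) (F.reg_cinv i α₀ U hM hα₀ hMa hU) hK'' α₁ hα₁.le ha2
    (F.expA i U U') (F.kF i U U') (F.sF i U U') hkF hsF h337s hA hAτ hQm hQsm hFc hFcs
  rw [← hG] at hT1 hT2
  have hC := F.cop_eq i ((bg i).mul U' U) _ Tinv rfl hT1 hT2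
  rw [← hC] at hker
  exact F.writeKer i U U' α₁ _ _ hα₁ haW hU' hB' hδ'
    (kerBound_exp_change (F.len_pos i) (F.Cop i ((bg i).mul U' U)) (F.d261 (F.rate (min δ₀ δ₁))) F.dB hker)

/-! ## The (3.47) global block and the (3.43) Hölder block of G′(U′U) at the letters

Two more frames on the SAME letters (`GpFrame₂`): the global block (3.47) is written from the same four (3.42)-type majorants
of G′(U′U) (p. 398: *"the global inequalities (3.47) are consequences of the local ones (3.42) and Lemma 2.1"* — at the
letters this is `B9Ineq347AllEntries`, applied by the instance inside `writeGlob`), and the Hölder block (3.43) from r06's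
PER-PROBE transfers `thm34_Gp_holderLeft_uniform` ∕ `thm34_Gp_holderRight_uniform` (derivative on
the left ∕ on the right; a probe = a left or right letter `D`, a real-linear functional `Φ` of the 𝔸-valued output, an anchor
block `y ∋ p₀`, an exponent β and sizes `B_h, c_ζ`), handed to the instance as the single field `h1_transfer`. -/

/-- **The (3.42) entries of G′(U′U) at the letters** — the common core of the (3.42)- and (3.47)-steps: for every input
(B₀, δ₀) > 0 there are `a₁ > 0`, `B ≧ 0` (before the member) such that at every (3.35)-regular U above the threshold
`Mthr (rate δ₀)` with the (3.42) block of the family at (B₀, δ₀), and every U′ in (3.37) at α₁ ≦ a₁, the family's `G′(U′U)` carries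
the four majorants (entry, left differences, right differences, Laplacian letter) at (B, 9δr/10), δr = `rate δ₀` the call rate.
(`thm34_Gp_uniform` (R1) + `gop_eq` ∘ `mul_law`.) [cite: Balaban1985BackgroundPropagators, Thm 3.4 p.400 + (3.60)–(3.65) p.402 + Thm 3.1 (3.42) p.397] -/
theorem entries342_ext_of_gpFrame₂ (F : GpFrame₂ c35 geo bg Gp b κ S) {B₀ δ₀ : ℝ} (hB₀ : 0 < B₀) (hδ₀ : 0 < δ₀) :
    ∃ a₁ : ℝ, 0 < a₁ ∧ ∃ B : ℝ, 0 ≤ B ∧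
      ∀ (i : I) (α₀ : ℝ) (U : (bg i).Cfg), F.Mthr (F.rate δ₀) ≤ (geo i).M → 0 < α₀ → (geo i).M * α₀ ≤ F.aInv →
        (bg i).Reg335 c35 α₀ U → EBlock (Gp i) B₀ δ₀ U →
        ∀ (α₁ : ℝ) (U' : (bg i).Cfg), 0 < α₁ → α₁ ≤ a₁ → (bg i).Cplx337 α₁ U U' →
          HasMajorant (g := toB6 (geo i) (F.Rr i) (F.Hp i)) (fun p : S i × ι => F.blk i p.1) (F.Gop i ((bg i).mul U' U))
              (fun a a' => B * (geo i).len a ^ 2 * Real.exp (-(9 / 10 * F.rate δ₀ * (geo i).dist a a'))) ∧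
            (∀ k : κ ⊕ κ, HasMajorant (g := toB6 (geo i) (F.Rr i) (F.Hp i)) (fun p : S i × ι => F.blk i p.1)
              (conj b (diffLetter (F.T i) (F.coord i U) ((((geo i).eta : ℂ))⁻¹) k) * F.Gop i ((bg i).mul U' U))
              (fun a a' => B * (geo i).len a * Real.exp (-(9 / 10 * F.rate δ₀ * (geo i).dist a a')))) ∧
            (∀ k : κ ⊕ κ, HasMajorant (g := toB6 (geo i) (F.Rr i) (F.Hp i)) (fun p : S i × ι => F.blk i p.1)
              (F.Gop i ((bg i).mul U' U) * conj b (diffLetter (F.T i) (F.coord i U) ((((geo i).eta : ℂ))⁻¹) k))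
              (fun a a' => B * (geo i).len a * Real.exp (-(9 / 10 * F.rate δ₀ * (geo i).dist a a')))) ∧
            HasMajorant (g := toB6 (geo i) (F.Rr i) (F.Hp i)) (fun p : S i × ι => F.blk i p.1)
              (F.Lap i U * F.Gop i ((bg i).mul U' U))
              (fun a a' => B * 1 * Real.exp (-(9 / 10 * F.rate δ₀ * (geo i).dist a a'))) := by
  have hδr : 0 < F.rate δ₀ := F.rate_pos hδ₀
  obtain ⟨a₁, ha₁, B, hB, H⟩ := thm34_Gp_uniform b κ (F.d261 (F.rate δ₀)) (F.rate δ₀) (F.cR * B₀) F.Cq F.a₀ F.d₀ F.M₂ (F.Λf (F.rate δ₀))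
    (mul_pos F.cR_pos hB₀) F.Cq_nonneg F.a₀_nonneg F.M₂_nonneg hδr (fun α hα => F.Λf_one_le _ α hδr hα) F.hrepr
  refine ⟨a₁, ha₁, B, hB, ?_⟩
  intro i α₀ U hM0 hα₀ hMa hU hE α₁ U' hα₁ ha hU'
  have hM : F.MInv ≤ (geo i).M := F.MInv_le_of_Mthr_le hM0
  obtain ⟨hΔG, hGΔ⟩ := F.reg_inv i α₀ U hM hα₀ hMa hU
  obtain ⟨h1, h2, h3, hL⟩ := F.read342_le i α₀ U hM hα₀ hMa hU hB₀ hδ₀ (F.rate_le δ₀) hE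
  obtain ⟨hkF, hsF, h337s, h337F, h337B, hA, hAτ⟩ := F.cplx i α₁ U U' hα₁ hU'
  obtain ⟨hinv1, hinv2, hleft, hright⟩ := H (F.T i) (F.coord i U) (F.blk i) (F.kQ i U) (F.sQ i U) (F.cfun i) (F.w i U)
    (F.dist_nonneg i) (F.triangle i) (F.dist_self i) (F.dist_comm i) (F.len_pos i) (F.eta_le_len i) (F.eta_pos i)
    (F.h261_of i hδr (F.rate_le_cap δ₀) hM0) (F.hST_of i hδr (F.rate_le_cap δ₀) hM0) (F.unitary i U)
    (F.stencilB i) (F.stencilF i) (F.stencil0 i) (F.w_nonneg i U) (F.card_w i U) (F.hkQ i U) (F.hsQ i U) (F.hcfun i)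
    hΔG hGΔ h1 h2 h3 α₁ hα₁.le ha (F.expA i U U') (F.kF i U U') (F.sF i U U')
    hkF hsF h337s h337F h337B hA hAτ
  have hG := F.gop_eq i ((bg i).mul U' U) _ _ (F.mul_law i α₁ U U' hα₁ hU') hinv1 hinv2
  rw [← hG] at hleft hright
  have e0 : HasMajorant (g := toB6 (geo i) (F.Rr i) (F.Hp i)) (fun p : S i × ι => F.blk i p.1)
      (1 * F.Gop i ((bg i).mul U' U))
      (fun a a' => B * (geo i).len a ^ 2 * Real.exp (-(9 / 10 * F.rate δ₀ * (geo i).dist a a'))) :=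
    hleft 1 (fun a => (geo i).len a ^ 2) (fun a => sq_nonneg _) (by simpa only [one_mul] using h1)
  rw [one_mul] at e0
  exact ⟨e0, fun k => hleft _ (fun a => (geo i).len a) (fun a => (F.len_pos i a).le) (h2 k),
    fun k => hright _ (h3 k), hleft _ (fun _ => (1 : ℝ)) (fun _ => zero_le_one) hL⟩

variable (c35 geo bg Gp b κ S) in
/-- **THE LETTERS DICTIONARY FOR THE GLOBAL BLOCK (3.47) OF G′** — `GpFrame₂` plus the writing of the four (3.42)-type majorants of
`G′(U′U)` as the (3.47) block of the family at U′U (the instance's (3.47)-from-(3.42) reading, p. 398, at the letters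
`B9Ineq347AllEntries`; writing function `wG`).  A hypothesis structure; nothing asserted.
[cite: Balaban1985BackgroundPropagators, (3.47) p.398 + p.402; Balaban1984PropagatorsII, Lemma 2.1 p.234] -/
structure GlobFrame₂ extends GpFrame₂ c35 geo bg Gp b κ S where
  wG : ℝ → ℝ → ℝ
  wG_pos : ∀ B δ : ℝ, 0 ≤ B → 0 < δ → 0 < wG B δ
  /-- WRITING (3.47): the four majorants of G′(U′U) at (B, δ) ⇒ the (3.47) block of the family at U′U with constant `wG B δ`. -/
  writeGlob : ∀ i (U U' : (bg i).Cfg) (α₁ B δ : ℝ), 0 < α₁ → α₁ ≤ aW → (bg i).Cplx337 α₁ U U' → 0 ≤ B → 0 < δ →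
    HasMajorant (g := toB6 (geo i) (Rr i) (Hp i)) (fun p : S i × ι => blk i p.1) (Gop i ((bg i).mul U' U))
        (fun a a' => B * (geo i).len a ^ 2 * Real.exp (-(δ * (geo i).dist a a'))) →
    (∀ k : κ ⊕ κ, HasMajorant (g := toB6 (geo i) (Rr i) (Hp i)) (fun p : S i × ι => blk i p.1)
        (conj b (diffLetter (T i) (coord i U) ((((geo i).eta : ℂ))⁻¹) k) * Gop i ((bg i).mul U' U))
        (fun a a' => B * (geo i).len a * Real.exp (-(δ * (geo i).dist a a')))) →
    (∀ k : κ ⊕ κ, HasMajorant (g := toB6 (geo i) (Rr i) (Hp i)) (fun p : S i × ι => blk i p.1)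
        (Gop i ((bg i).mul U' U) * conj b (diffLetter (T i) (coord i U) ((((geo i).eta : ℂ))⁻¹) k))
        (fun a a' => B * (geo i).len a * Real.exp (-(δ * (geo i).dist a a')))) →
    HasMajorant (g := toB6 (geo i) (Rr i) (Hp i)) (fun p : S i × ι => blk i p.1) (Lap i U * Gop i ((bg i).mul U' U))
        (fun a a' => B * 1 * Real.exp (-(δ * (geo i).dist a a'))) →
    B9FromB6.GlobBlock (Gp i) (wG B δ) ((bg i).mul U' U)

/-- ★ **THE (3.47)-STEP OF SECT. B FOR G′(U′U), INHABITED AT THE LETTERS**: every `GlobFrame₂` inhabits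
`B9SectBStepWhole.StepGlobPos d c35 geo bg Gp GA Cinv Gp` (output constant `wG B (9δr/10)`, δr = `rate δ₀`), by `entries342_ext_of_gpFrame₂` and
the frame's (3.47) writing. [cite: Balaban1985BackgroundPropagators, Thm 3.4 p.400 + (3.47) p.398 + p.402] -/
theorem stepGlobPos_of_globFrame₂ (F : GlobFrame₂ c35 geo bg Gp b κ S)
    (GA : ∀ i, B9.KernelFamily (geo i) (bg i)) (Cinv : ∀ i, B9.SiteKernel (geo i) (bg i)) :
    B9SectBStepWhole.StepGlobPos d c35 geo bg Gp GA Cinv Gp := by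
  intro B₀ δ₀ Bβ Bε Bεβ B₁ δ₁ hB₀ hδ₀ _ _
  obtain ⟨a₁, ha₁, B, hB, H⟩ := entries342_ext_of_gpFrame₂ F.toGpFrame₂ hB₀ hδ₀
  have hδ' : 0 < 9 / 10 * F.rate δ₀ := by have := F.rate_pos hδ₀; positivity
  refine ⟨F.Mthr (F.rate δ₀), min a₁ F.aW, F.aInv, F.wG B (9 / 10 * F.rate δ₀), F.Mthr_pos _, lt_min ha₁ F.aW_pos,
    F.aInv_pos, F.wG_pos B _ hB hδ', ?_⟩
  intro i hM0 α₀ hα₀ hMa U hU hT α₁ hα₁ ha U' hU'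
  obtain ⟨e0, e1, e2, e3⟩ := H i α₀ U hM0 hα₀ hMa hU hT.1.1.1 α₁ U' hα₁ (le_trans ha (min_le_left _ _)) hU'
  exact F.writeGlob i U U' α₁ B (9 / 10 * F.rate δ₀) hα₁ (le_trans ha (min_le_right _ _)) hU' hB hδ' e0 e1 e2 e3

variable (c35 geo bg Gp b κ S) in
/-- **THE LETTERS DICTIONARY FOR THE HÖLDER BLOCK (3.43) OF G′** — `GpFrame₂` plus ONE transfer field: given the (3.42) and (3.43)
blocks of the family at U and r06's two PER-PROBE Hölder transfers for the family's own `G′(U′U)` (derivative on the left: for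
every left letter `D`, functional `Φ`, anchor `y ∋ p₀`, exponent β, sizes `B_h, c_ζ ≧ 0`, the probe bound for `G′(U)` implies
the probe bound for `G′(U′U)` with `B_L·B_h` at rate 9δ/10; derivative on the right: the same for right letters `D` with a
(3.42)₃-type entry, from the three probe bounds (a) (b) (c)), the (3.43) block of the family holds at U′U with
(`wH B_L B_R δ B₀(·)`, `wHδ δ`).  The probes are the instance's Hölder difference quotients (3.40); nothing asserted.
[cite: Balaban1985BackgroundPropagators, (3.43) p.398 + (3.40) p.397 + p.402; Balaban1984PropagatorsII, (2.51) p.232] -/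
structure H1Frame₂ extends GpFrame₂ c35 geo bg Gp b κ S where
  wH : ℝ → ℝ → ℝ → (ℝ → ℝ) → (ℝ → ℝ)
  wHδ : ℝ → ℝ
  wHδ_pos : ∀ δ : ℝ, 0 < δ → 0 < wHδ δ
  /-- THE TRANSFER (v2: at a call rate `δc ≦ δ`): r06's per-probe (3.43) transfers (left and right, inputs at rate δc, outputs at
  9δc∕10) for `G′(U′U)` ⇒ the (3.43) block of the family at U′U, given the (3.42) ∕ (3.43) blocks at U at rate δ. -/
  h1_transfer : ∀ i (α₀ : ℝ) (U U' : (bg i).Cfg) (α₁ B₀ BL BR δ δc : ℝ) (Bβ : ℝ → ℝ),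
    MInv ≤ (geo i).M → 0 < α₀ → (geo i).M * α₀ ≤ aInv → (bg i).Reg335 c35 α₀ U →
    0 < α₁ → α₁ ≤ aW → (bg i).Cplx337 α₁ U U' → 0 < B₀ → 0 ≤ BL → 0 ≤ BR → 0 < δ → 0 < δc → δc ≤ δ →
    EBlock (Gp i) B₀ δ U → B9FromB6.H1Block (Gp i) Bβ δ U →
    -- r06's left transfer AT THE CALL RATE δc ≦ δ, for every probe
    (∀ (D : Module.End ℝ (S i × ι → ℝ)) (Φ : (S i → 𝔸) →ₗ[ℝ] 𝔸) (y : (geo i).Site) (p₀ : S i × ι), blk i p₀.1 = y →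
      ∀ (β Bh cζ : ℝ), 0 ≤ Bh → 0 ≤ cζ →
        (∀ (y' : (geo i).Site) (μ : S i × ι → ℝ) (M : ℝ),
          B6RandomWalk.BlockSupp (g := toB6 (geo i) (Rr i) (Hp i)) (fun p : S i × ι => blk i p.1) μ y' M →
          ‖Φ ((B9Eq352DivFormLetters.coordEquiv b).symm (D (Gop i U μ)))‖ ≤
            Bh * (geo i).len y ^ (1 - β) * cζ * Real.exp (-(δc * (geo i).dist y y')) * M) →
        ∀ (y' : (geo i).Site) (μ : S i × ι → ℝ) (M : ℝ),
          B6RandomWalk.BlockSupp (g := toB6 (geo i) (Rr i) (Hp i)) (fun p : S i × ι => blk i p.1) μ y' M →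
          ‖Φ ((B9Eq352DivFormLetters.coordEquiv b).symm (D (Gop i ((bg i).mul U' U) μ)))‖ ≤
            BL * Bh * (geo i).len y ^ (1 - β) * cζ * Real.exp (-(9 / 10 * δc * (geo i).dist y y')) * M) →
    -- r06's right transfer AT THE CALL RATE δc, for every right letter with a (3.42)₃-type entry and every probe
    (∀ (D : Module.End ℝ (S i × ι → ℝ)),
      HasMajorant (g := toB6 (geo i) (Rr i) (Hp i)) (fun p : S i × ι => blk i p.1) (Gop i U * D)
        (fun a a' => cR * B₀ * (geo i).len a * Real.exp (-(δc * (geo i).dist a a'))) →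
      ∀ (Φ : (S i → 𝔸) →ₗ[ℝ] 𝔸) (y : (geo i).Site) (p₀ : S i × ι), blk i p₀.1 = y →
      ∀ (β Bh cζ : ℝ), 0 ≤ Bh → 0 ≤ cζ →
        (∀ (y' : (geo i).Site) (μ : S i × ι → ℝ) (M : ℝ),
          B6RandomWalk.BlockSupp (g := toB6 (geo i) (Rr i) (Hp i)) (fun p : S i × ι => blk i p.1) μ y' M →
          ‖Φ ((B9Eq352DivFormLetters.coordEquiv b).symm (Gop i U μ))‖ ≤
            Bh * (geo i).len y ^ (2 - β) * cζ * Real.exp (-(δc * (geo i).dist y y')) * M) →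
        (∀ (k : κ ⊕ κ) (y' : (geo i).Site) (μ : S i × ι → ℝ) (M : ℝ),
          B6RandomWalk.BlockSupp (g := toB6 (geo i) (Rr i) (Hp i)) (fun p : S i × ι => blk i p.1) μ y' M →
          ‖Φ ((B9Eq352DivFormLetters.coordEquiv b).symm
              ((Gop i U * conj b (diffLetter (T i) (coord i U) ((((geo i).eta : ℂ))⁻¹) k)) μ))‖ ≤
            Bh * (geo i).len y ^ (1 - β) * cζ * Real.exp (-(δc * (geo i).dist y y')) * M) →
        (∀ (y' : (geo i).Site) (μ : S i × ι → ℝ) (M : ℝ),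
          B6RandomWalk.BlockSupp (g := toB6 (geo i) (Rr i) (Hp i)) (fun p : S i × ι => blk i p.1) μ y' M →
          ‖Φ ((B9Eq352DivFormLetters.coordEquiv b).symm ((Gop i U * D) μ))‖ ≤
            Bh * (geo i).len y ^ (1 - β) * cζ * Real.exp (-(δc * (geo i).dist y y')) * M) →
        ∀ (y' : (geo i).Site) (μ : S i × ι → ℝ) (M : ℝ),
          B6RandomWalk.BlockSupp (g := toB6 (geo i) (Rr i) (Hp i)) (fun p : S i × ι => blk i p.1) μ y' M →
          ‖Φ ((B9Eq352DivFormLetters.coordEquiv b).symm ((Gop i ((bg i).mul U' U) * D) μ))‖ ≤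
            BR * Bh * (geo i).len y ^ (1 - β) * cζ * Real.exp (-(9 / 10 * δc * (geo i).dist y y')) * M) →
    B9FromB6.H1Block (Gp i) (wH BL BR δc Bβ) (wHδ δc) ((bg i).mul U' U)

/-- ★ **THE (3.43)-STEP OF SECT. B FOR G′(U′U), INHABITED AT THE LETTERS**: every `H1Frame₂` inhabits
`B9SectBStepWhole.StepH1Pos d c35 geo bg Gp GA Cinv Gp` (outputs `wH B_L B_R δr B₀(·)`, `wHδ δr`, δr = `rate δ₀` the call rate).  Proof: r06's (R1)
`thm34_Gp_holderLeft_uniform` and `thm34_Gp_holderRight_uniform` (constants `a₁, B_L`, `a₁′, B_R` before the member) plus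
`thm34_Gp_uniform` for the inverse identities that identify the family's `G′(U′U)` with r06's extension (`gop_eq`), then the
frame's transfer field. [cite: Balaban1985BackgroundPropagators, Thm 3.4 p.400 + Thm 3.1 (3.43) p.398 + (3.60)–(3.65) pp.402–403; Balaban1984PropagatorsII, Lemma 2.1 p.234] -/
theorem stepH1Pos_of_h1Frame₂ (F : H1Frame₂ c35 geo bg Gp b κ S)
    (GA : ∀ i, B9.KernelFamily (geo i) (bg i)) (Cinv : ∀ i, B9.SiteKernel (geo i) (bg i)) :
    B9SectBStepWhole.StepH1Pos d c35 geo bg Gp GA Cinv Gp := by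
  intro B₀ δ₀ Bβ Bε Bεβ B₁ δ₁ hB₀ hδ₀ _ _
  have hBG : 0 < F.cR * B₀ := mul_pos F.cR_pos hB₀
  have hδr : 0 < F.rate δ₀ := F.rate_pos hδ₀
  -- r06's three uniform theorems (R1) at the call rate
  obtain ⟨aE, haE, BE, -, HE⟩ := thm34_Gp_uniform b κ (F.d261 (F.rate δ₀)) (F.rate δ₀) (F.cR * B₀) F.Cq F.a₀ F.d₀ F.M₂ (F.Λf (F.rate δ₀))
    hBG F.Cq_nonneg F.a₀_nonneg F.M₂_nonneg hδr (fun α hα => F.Λf_one_le _ α hδr hα) F.hrepr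
  obtain ⟨aL, haL, BL, hBL, HL⟩ := thm34_Gp_holderLeft_uniform b κ (F.d261 (F.rate δ₀)) (F.rate δ₀) (F.cR * B₀) F.Cq F.a₀
    F.d₀ F.M₂ (F.Λf (F.rate δ₀)) hBG F.Cq_nonneg F.a₀_nonneg F.M₂_nonneg hδr (fun α hα => F.Λf_one_le _ α hδr hα) F.hrepr
  obtain ⟨aR, haR, BR, hBR, HR⟩ := thm34_Gp_holderRight_uniform b κ (F.d261 (F.rate δ₀)) (F.rate δ₀) (F.cR * B₀) F.Cq F.a₀
    F.d₀ F.M₂ (F.Λf (F.rate δ₀)) hBG F.Cq_nonneg F.a₀_nonneg F.M₂_nonneg hδr (fun α hα => F.Λf_one_le _ α hδr hα) F.hrepr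
  refine ⟨F.Mthr (F.rate δ₀), min (min aE (min aL aR)) F.aW, F.aInv, (F.wH BL BR (F.rate δ₀) Bβ, F.wHδ (F.rate δ₀)),
    F.Mthr_pos _, lt_min (lt_min haE (lt_min haL haR)) F.aW_pos, F.aInv_pos, F.wHδ_pos _ hδr, ?_⟩
  intro i hM0 α₀ hα₀ hMa U hU hT α₁ hα₁ ha U' hU'
  have hM : F.MInv ≤ (geo i).M := F.MInv_le_of_Mthr_le hM0
  have haE' : α₁ ≤ aE := le_trans ha (le_trans (min_le_left _ _) (min_le_left _ _))
  have haL' : α₁ ≤ aL := le_trans ha (le_trans (min_le_left _ _) (le_trans (min_le_right _ _) (min_le_left _ _)))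
  have haR' : α₁ ≤ aR := le_trans ha (le_trans (min_le_left _ _) (le_trans (min_le_right _ _) (min_le_right _ _)))
  have haW : α₁ ≤ F.aW := le_trans ha (min_le_right _ _)
  obtain ⟨hΔG, hGΔ⟩ := F.reg_inv i α₀ U hM hα₀ hMa hU
  obtain ⟨h1, h2, h3, -⟩ := F.read342_le i α₀ U hM hα₀ hMa hU hB₀ hδ₀ (F.rate_le δ₀) hT.1.1.1
  obtain ⟨hkF, hsF, h337s, h337F, h337B, hA, hAτ⟩ := F.cplx i α₁ U U' hα₁ hU'
  -- the inverse identities ⇒ the family's G′(U′U) is r06's extension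
  obtain ⟨hinv1, hinv2, -, -⟩ := HE (F.T i) (F.coord i U) (F.blk i) (F.kQ i U) (F.sQ i U) (F.cfun i) (F.w i U)
    (F.dist_nonneg i) (F.triangle i) (F.dist_self i) (F.dist_comm i) (F.len_pos i) (F.eta_le_len i) (F.eta_pos i)
    (F.h261_of i hδr (F.rate_le_cap δ₀) hM0) (F.hST_of i hδr (F.rate_le_cap δ₀) hM0) (F.unitary i U)
    (F.stencilB i) (F.stencilF i) (F.stencil0 i) (F.w_nonneg i U) (F.card_w i U) (F.hkQ i U) (F.hsQ i U) (F.hcfun i)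
    hΔG hGΔ h1 h2 h3 α₁ hα₁.le haE' (F.expA i U U') (F.kF i U U') (F.sF i U U')
    hkF hsF h337s h337F h337B hA hAτ
  have hG := F.gop_eq i ((bg i).mul U' U) _ _ (F.mul_law i α₁ U U' hα₁ hU') hinv1 hinv2
  -- r06's two per-probe Hölder transfers at this member, background and exponent field (at the call rate)
  have HL' := HL (F.T i) (F.coord i U) (F.blk i) (F.kQ i U) (F.sQ i U) (F.cfun i) (F.w i U)
    (F.dist_nonneg i) (F.triangle i) (F.dist_self i) (F.dist_comm i) (F.len_pos i) (F.eta_le_len i) (F.eta_pos i)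
    (F.h261_of i hδr (F.rate_le_cap δ₀) hM0) (F.hST_of i hδr (F.rate_le_cap δ₀) hM0) (F.unitary i U)
    (F.stencilB i) (F.stencilF i) (F.stencil0 i) (F.w_nonneg i U) (F.card_w i U) (F.hkQ i U) (F.hsQ i U) (F.hcfun i)
    hΔG hGΔ h1 h2 h3 α₁ hα₁.le haL' (F.expA i U U') (F.kF i U U') (F.sF i U U')
    hkF hsF h337s h337F h337B hA hAτ
  have HR' := HR (F.T i) (F.coord i U) (F.blk i) (F.kQ i U) (F.sQ i U) (F.cfun i) (F.w i U)
    (F.dist_nonneg i) (F.triangle i) (F.dist_self i) (F.dist_comm i) (F.len_pos i) (F.eta_le_len i) (F.eta_pos i)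
    (F.h261_of i hδr (F.rate_le_cap δ₀) hM0) (F.hST_of i hδr (F.rate_le_cap δ₀) hM0) (F.unitary i U)
    (F.stencilB i) (F.stencilF i) (F.stencil0 i) (F.w_nonneg i U) (F.card_w i U) (F.hkQ i U) (F.hsQ i U) (F.hcfun i)
    hΔG hGΔ h1 h2 h3 α₁ hα₁.le haR' (F.expA i U U') (F.kF i U U') (F.sF i U U')
    hkF hsF h337s h337F h337B hA hAτ
  rw [← hG] at HL' HR'
  exact F.h1_transfer i α₀ U U' α₁ B₀ BL BR δ₀ (F.rate δ₀) Bβ hM hα₀ hMa hU hα₁ haW hU' hB₀ hBL hBR hδ₀ hδr (F.rate_le δ₀)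
    hT.1.1.1 hT.1.2.1 HL' HR'


/-! ## The input-Hölder blocks (3.44) ∕ (3.45) of G′(U′U) at the letters

The same letters once more; r06's `thm34_Gp_holderInput_uniform` transfers, PER INPUT (a pair of
letters `D_l`, `D_s` with (3.42)₂ ∕ (3.42)₃-type entries, a block-supported `μ` with bound `M`, the (3.44) datum `N` of the
unperturbed G′(U)) and PER PROBE (`Φ`, anchor, exponent, sizes; the (3.45) datum `N₂`), the (3.44)- and (3.45)-type members
from G′(U) to G′(U′U) («of course with different constants»); the instance turns the family of these transfers for ITS inputs
and probes into the (3.44) ∕ (3.45) blocks of the family at U′U — the single field `e4h2_transfer`. -/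

variable (c35 geo bg Gp b κ S) in
/-- **THE LETTERS DICTIONARY FOR THE INPUT-HÖLDER BLOCKS (3.44) ∕ (3.45) OF G′** — `GpFrame₂` plus ONE transfer field: given the
(3.42) and (3.43)–(3.45) blocks of the family at U and r06's per-input ∕ per-probe transfers (v′) (sup output) and (vi′) (Hölder
output) for the family's own `G′(U′U)`, the (3.44) and (3.45) blocks of the family hold at U′U with (`wE4 B δ B′₀(·)`, `wHδ′ δ`)
and (`wH2 B δ B₀(·) B′₀(·,·)`, `wHδ′ δ`).  Field shapes = the conclusions (v′), (vi′) of `thm34_Gp_holderInput_uniform` verbatim.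
A hypothesis structure; nothing asserted. [cite: Balaban1985BackgroundPropagators, (3.44)–(3.45) p.398 + (3.40) p.397 + (3.65) p.402 + p.403 l.2–5; Balaban1984PropagatorsII, (2.51)–(2.52) p.232 + Lemma 2.1 p.234] -/
structure E4H2Frame₂ extends GpFrame₂ c35 geo bg Gp b κ S where
  wE4 : ℝ → ℝ → (ℝ → ℝ) → (ℝ → ℝ)
  wH2 : ℝ → ℝ → (ℝ → ℝ) → (ℝ → ℝ → ℝ) → (ℝ → ℝ → ℝ)
  wHδ' : ℝ → ℝ
  wHδ'_pos : ∀ δ : ℝ, 0 < δ → 0 < wHδ' δ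
  /-- THE TRANSFER (v2: at a call rate `δc ≦ δ`): r06's per-input (v′) and per-probe (vi′) input-Hölder transfers (inputs at rate δc,
  outputs at 4δc∕5) for `G′(U′U)` ⇒ the (3.44), (3.45) blocks at U′U, given the (3.42) ∕ (3.43)–(3.45) blocks at U at rate δ. -/
  e4h2_transfer : ∀ i (α₀ : ℝ) (U U' : (bg i).Cfg) (α₁ B₀ B δ δc : ℝ) (Bβ Bε : ℝ → ℝ) (Bεβ : ℝ → ℝ → ℝ),
    MInv ≤ (geo i).M → 0 < α₀ → (geo i).M * α₀ ≤ aInv → (bg i).Reg335 c35 α₀ U →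
    0 < α₁ → α₁ ≤ aW → (bg i).Cplx337 α₁ U U' → 0 < B₀ → 0 ≤ B → 0 < δ → 0 < δc → δc ≤ δ →
    EBlock (Gp i) B₀ δ U → B9.Ineq343_345 (Gp i) Bβ Bε Bεβ δ U →
    -- (v′) the (3.44)-type member AT THE CALL RATE δc ≦ δ, per pair of letters and per input
    (∀ (Dl Ds : Module.End ℝ (S i × ι → ℝ)),
      HasMajorant (g := toB6 (geo i) (Rr i) (Hp i)) (fun p : S i × ι => blk i p.1) (Dl * Gop i U)
        (fun a a' => cR * B₀ * (geo i).len a * Real.exp (-(δc * (geo i).dist a a'))) →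
      HasMajorant (g := toB6 (geo i) (Rr i) (Hp i)) (fun p : S i × ι => blk i p.1) (Gop i U * Ds)
        (fun a a' => cR * B₀ * (geo i).len a * Real.exp (-(δc * (geo i).dist a a'))) →
      ∀ (y' : (geo i).Site) (μ : S i × ι → ℝ) (M : ℝ),
        B6RandomWalk.BlockSupp (g := toB6 (geo i) (Rr i) (Hp i)) (fun p : S i × ι => blk i p.1) μ y' M →
      ∀ (N : ℝ), 0 ≤ N →
        (∀ (k : κ ⊕ κ) (z : S i × ι),
          |(((conj b (diffLetter (T i) (coord i U) ((((geo i).eta : ℂ))⁻¹) k)) * Gop i U * Ds) μ) z| ≤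
            N * Real.exp (-(δc * (geo i).dist (blk i z.1) y'))) →
        (∀ z : S i × ι, |((Dl * Gop i U * Ds) μ) z| ≤ N * Real.exp (-(δc * (geo i).dist (blk i z.1) y'))) →
        ∀ x : S i × ι, |((Dl * Gop i ((bg i).mul U' U) * Ds) μ) x| ≤
          B * (N + M) * Real.exp (-(4 / 5 * δc * (geo i).dist (blk i x.1) y'))) →
    -- (vi′) the (3.45)-type member AT THE CALL RATE δc, per pair of letters, per probe and per input
    (∀ (Dl Ds : Module.End ℝ (S i × ι → ℝ)),
      HasMajorant (g := toB6 (geo i) (Rr i) (Hp i)) (fun p : S i × ι => blk i p.1) (Dl * Gop i U)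
        (fun a a' => cR * B₀ * (geo i).len a * Real.exp (-(δc * (geo i).dist a a'))) →
      HasMajorant (g := toB6 (geo i) (Rr i) (Hp i)) (fun p : S i × ι => blk i p.1) (Gop i U * Ds)
        (fun a a' => cR * B₀ * (geo i).len a * Real.exp (-(δc * (geo i).dist a a'))) →
      ∀ (Φ : (S i → 𝔸) →ₗ[ℝ] 𝔸) (y : (geo i).Site) (p₀ : S i × ι), blk i p₀.1 = y →
      ∀ (γ Bh cζ : ℝ), 0 ≤ Bh → 0 ≤ cζ →
        (∀ (y'' : (geo i).Site) (ν : S i × ι → ℝ) (C : ℝ),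
          B6RandomWalk.BlockSupp (g := toB6 (geo i) (Rr i) (Hp i)) (fun p : S i × ι => blk i p.1) ν y'' C →
          ‖Φ ((B9Eq352DivFormLetters.coordEquiv b).symm (Dl (Gop i U ν)))‖ ≤
            Bh * (geo i).len y ^ (1 - γ) * cζ * Real.exp (-(δc * (geo i).dist y y'')) * C) →
      ∀ (y' : (geo i).Site) (μ : S i × ι → ℝ) (M : ℝ),
        B6RandomWalk.BlockSupp (g := toB6 (geo i) (Rr i) (Hp i)) (fun p : S i × ι => blk i p.1) μ y' M →
      ∀ (N : ℝ), 0 ≤ N →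
        (∀ (k : κ ⊕ κ) (z : S i × ι),
          |(((conj b (diffLetter (T i) (coord i U) ((((geo i).eta : ℂ))⁻¹) k)) * Gop i U * Ds) μ) z| ≤
            N * Real.exp (-(δc * (geo i).dist (blk i z.1) y'))) →
      ∀ (N₂ : ℝ), 0 ≤ N₂ →
        ‖Φ ((B9Eq352DivFormLetters.coordEquiv b).symm ((Dl * Gop i U * Ds) μ))‖ ≤ N₂ * Real.exp (-(δc * (geo i).dist y y')) →
        ‖Φ ((B9Eq352DivFormLetters.coordEquiv b).symm ((Dl * Gop i ((bg i).mul U' U) * Ds) μ))‖ ≤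
          B * (N₂ + Bh * (geo i).len y ^ (1 - γ) * cζ * ((geo i).len y)⁻¹ * (N + M)) *
            Real.exp (-(4 / 5 * δc * (geo i).dist y y'))) →
    B9FromB6.E4Block (Gp i) (wE4 B δc Bε) (wHδ' δc) ((bg i).mul U' U) ∧
      B9FromB6.H2Block (Gp i) (wH2 B δc Bβ Bεβ) (wHδ' δc) ((bg i).mul U' U)

/-- The two input-Hölder blocks of G′(U′U) at the letters, in one positive-input step (product of outputs).
[cite: Balaban1985BackgroundPropagators, Thm 3.4 p.400 + (3.44)–(3.45) p.398 + (3.65) p.402] -/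
theorem stepE4H2Pos_of_e4h2Frame₂ (F : E4H2Frame₂ c35 geo bg Gp b κ S)
    (GA : ∀ i, B9.KernelFamily (geo i) (bg i)) (Cinv : ∀ i, B9.SiteKernel (geo i) (bg i)) :
    StepPos d c35 geo bg Gp GA Cinv (((ℝ → ℝ) × ℝ) × ((ℝ → ℝ → ℝ) × ℝ)) (fun c => 0 < c.1.2 ∧ 0 < c.2.2)
      (fun c i U α₁ => ∀ U' : (bg i).Cfg, (bg i).Cplx337 α₁ U U' →
        B9FromB6.E4Block (Gp i) c.1.1 c.1.2 ((bg i).mul U' U) ∧ B9FromB6.H2Block (Gp i) c.2.1 c.2.2 ((bg i).mul U' U)) := by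
  intro B₀ δ₀ Bβ Bε Bεβ B₁ δ₁ hB₀ hδ₀ _ _
  have hBG : 0 < F.cR * B₀ := mul_pos F.cR_pos hB₀
  have hδr : 0 < F.rate δ₀ := F.rate_pos hδ₀
  obtain ⟨a₁, ha₁, B, hB, H⟩ := thm34_Gp_holderInput_uniform b κ (F.d261 (F.rate δ₀)) (F.rate δ₀) (F.cR * B₀) F.Cq F.a₀
    F.d₀ F.M₂ (F.Λf (F.rate δ₀)) hBG F.Cq_nonneg F.a₀_nonneg F.M₂_nonneg hδr (fun α hα => F.Λf_one_le _ α hδr hα) F.hrepr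
  refine ⟨F.Mthr (F.rate δ₀), min a₁ F.aW, F.aInv,
    ((F.wE4 B (F.rate δ₀) Bε, F.wHδ' (F.rate δ₀)), (F.wH2 B (F.rate δ₀) Bβ Bεβ, F.wHδ' (F.rate δ₀))), F.Mthr_pos _,
    lt_min ha₁ F.aW_pos, F.aInv_pos, ⟨F.wHδ'_pos _ hδr, F.wHδ'_pos _ hδr⟩, ?_⟩
  intro i hM0 α₀ hα₀ hMa U hU hT α₁ hα₁ ha U' hU'
  have hM : F.MInv ≤ (geo i).M := F.MInv_le_of_Mthr_le hM0
  obtain ⟨hΔG, hGΔ⟩ := F.reg_inv i α₀ U hM hα₀ hMa hU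
  obtain ⟨h1, h2, h3, -⟩ := F.read342_le i α₀ U hM hα₀ hMa hU hB₀ hδ₀ (F.rate_le δ₀) hT.1.1.1
  obtain ⟨hkF, hsF, h337s, h337F, h337B, hA, hAτ⟩ := F.cplx i α₁ U U' hα₁ hU'
  obtain ⟨hinv1, hinv2, hv, hvi⟩ := H (F.T i) (F.coord i U) (F.blk i) (F.kQ i U) (F.sQ i U) (F.cfun i) (F.w i U)
    (F.dist_nonneg i) (F.triangle i) (F.dist_self i) (F.dist_comm i) (F.len_pos i) (F.eta_le_len i) (F.eta_pos i)
    (F.h261_of i hδr (F.rate_le_cap δ₀) hM0) (F.hST_of i hδr (F.rate_le_cap δ₀) hM0) (F.unitary i U)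
    (F.stencilB i) (F.stencilF i) (F.stencil0 i) (F.w_nonneg i U) (F.card_w i U) (F.hkQ i U) (F.hsQ i U) (F.hcfun i)
    hΔG hGΔ h1 h2 h3 α₁ hα₁.le (le_trans ha (min_le_left _ _)) (F.expA i U U') (F.kF i U U') (F.sF i U U')
    hkF hsF h337s h337F h337B hA hAτ
  have hG := F.gop_eq i ((bg i).mul U' U) _ _ (F.mul_law i α₁ U U' hα₁ hU') hinv1 hinv2
  rw [← hG] at hv hvi
  exact F.e4h2_transfer i α₀ U U' α₁ B₀ B δ₀ (F.rate δ₀) Bβ Bε Bεβ hM hα₀ hMa hU hα₁ (le_trans ha (min_le_right _ _)) hU'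
    hB₀ hB hδ₀ hδr (F.rate_le δ₀) hT.1.1.1 hT.1.2 hv hvi

/-- ★ **THE (3.44)-STEP OF SECT. B FOR G′(U′U), INHABITED AT THE LETTERS** (projection of `stepE4H2Pos_of_e4h2Frame₂`).
[cite: Balaban1985BackgroundPropagators, Thm 3.4 p.400 + (3.44) p.398 + p.403 l.2–5] -/
theorem stepE4Pos_of_e4h2Frame₂ (F : E4H2Frame₂ c35 geo bg Gp b κ S)
    (GA : ∀ i, B9.KernelFamily (geo i) (bg i)) (Cinv : ∀ i, B9.SiteKernel (geo i) (bg i)) :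
    B9SectBStepWhole.StepE4Pos d c35 geo bg Gp GA Cinv Gp :=
  StepPos.mono (fun c => c.1) (fun _ h => h.1) (fun _ _ _ _ _ h U' hU' => (h U' hU').1) (stepE4H2Pos_of_e4h2Frame₂ F GA Cinv)

/-- ★ **THE (3.45)-STEP OF SECT. B FOR G′(U′U), INHABITED AT THE LETTERS** (projection of `stepE4H2Pos_of_e4h2Frame₂`).
[cite: Balaban1985BackgroundPropagators, Thm 3.4 p.400 + (3.45) p.398 + p.403 l.2–5] -/
theorem stepH2Pos_of_e4h2Frame₂ (F : E4H2Frame₂ c35 geo bg Gp b κ S)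
    (GA : ∀ i, B9.KernelFamily (geo i) (bg i)) (Cinv : ∀ i, B9.SiteKernel (geo i) (bg i)) :
    B9SectBStepWhole.StepH2Pos d c35 geo bg Gp GA Cinv Gp :=
  StepPos.mono (fun c => c.2) (fun _ h => h.2) (fun _ _ _ _ _ h U' hU' => (h U' hU').2) (stepE4H2Pos_of_e4h2Frame₂ F GA Cinv)



/-! ## The analytic-extension step of Theorem 3.4 for the G′ family at the letters -/

variable (c35 geo bg Gp b κ S) in
/-- **THE LETTERS DICTIONARY FOR THE ANALYTIC EXTENSION OF G′** — `GpFrame₂` plus ONE field: at a (3.35)-regular U above the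
thresholds and 0 < α₁ ≦ aW, if Δ′_a(U′U) is invertible with inverse the family's own G′(U′U) for EVERY U′ in the class (3.37) at
α₁, then the layer's predicate `IsAnalyticExt i (Gp i) U α₁` holds.  A hypothesis structure; nothing asserted.
[cite: Balaban1985BackgroundPropagators, Thm 3.4 p.400 + (3.62)–(3.64) p.402] -/
structure AnFrame₂ (IsAnalyticExt : ∀ i, B9.KernelFamily (geo i) (bg i) → (bg i).Cfg → ℝ → Prop)
    extends GpFrame₂ c35 geo bg Gp b κ S where
  writeAn : ∀ i (α₀ : ℝ) (U : (bg i).Cfg) (α₁ : ℝ), MInv ≤ (geo i).M → 0 < α₀ → (geo i).M * α₀ ≤ aInv →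
    (bg i).Reg335 c35 α₀ U → 0 < α₁ → α₁ ≤ aW →
    (∀ U' : (bg i).Cfg, (bg i).Cplx337 α₁ U U' →
      Δp i ((bg i).mul U' U) * Gop i ((bg i).mul U' U) = 1 ∧ Gop i ((bg i).mul U' U) * Δp i ((bg i).mul U' U) = 1) →
    IsAnalyticExt i (Gp i) U α₁


/-- ★ **THE ANALYTIC-EXTENSION STEP OF SECT. B FOR G′, INHABITED AT THE LETTERS**: every `AnFrame₂` inhabits
`B9SectBStepWhole.StepAnalyticPos1 d c35 geo bg Gp GA Cinv IsAnalyticExt Gp`.  Proof: `thm34_Gp_uniform` (i) gives, for every U′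
in the class at α₁ ≦ a₁, the two-sided inverse of Δ′_a(U) − V′(A) = Δ′_a(U′U) (`mul_law`), which IS the family's G′(U′U)
(`gop_eq`); then `writeAn`.  Thresholds M ≧ MInv, Mα₀ ≦ aInv, α₁ ≦ min(a₁, aW).
[cite: Balaban1985BackgroundPropagators, Thm 3.4 p.400 + (3.60)–(3.64) p.402] -/
theorem stepAnalyticPos1_of_anFrame₂ {IsAnalyticExt : ∀ i, B9.KernelFamily (geo i) (bg i) → (bg i).Cfg → ℝ → Prop}
    (F : AnFrame₂ c35 geo bg Gp b κ S IsAnalyticExt)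
    (GA : ∀ i, B9.KernelFamily (geo i) (bg i)) (Cinv : ∀ i, B9.SiteKernel (geo i) (bg i)) :
    StepAnalyticPos1 d c35 geo bg Gp GA Cinv IsAnalyticExt Gp := by
  intro B₀ δ₀ Bβ Bε Bεβ B₁ δ₁ hB₀ hδ₀ _ _
  have hδr : 0 < F.rate δ₀ := F.rate_pos hδ₀
  obtain ⟨a₁, ha₁, B, -, H⟩ := thm34_Gp_uniform b κ (F.d261 (F.rate δ₀)) (F.rate δ₀) (F.cR * B₀) F.Cq F.a₀ F.d₀ F.M₂ (F.Λf (F.rate δ₀))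
    (mul_pos F.cR_pos hB₀) F.Cq_nonneg F.a₀_nonneg F.M₂_nonneg hδr (fun α hα => F.Λf_one_le _ α hδr hα) F.hrepr
  refine ⟨F.Mthr (F.rate δ₀), min a₁ F.aW, F.aInv, PUnit.unit, F.Mthr_pos _, lt_min ha₁ F.aW_pos, F.aInv_pos, trivial, ?_⟩
  intro i hM0 α₀ hα₀ hMa U hU hT α₁ hα₁ ha
  have hM : F.MInv ≤ (geo i).M := F.MInv_le_of_Mthr_le hM0
  obtain ⟨hΔG, hGΔ⟩ := F.reg_inv i α₀ U hM hα₀ hMa hU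
  obtain ⟨h1, h2, h3, -⟩ := F.read342_le i α₀ U hM hα₀ hMa hU hB₀ hδ₀ (F.rate_le δ₀) hT.1.1.1
  refine F.writeAn i α₀ U α₁ hM hα₀ hMa hU hα₁ (le_trans ha (min_le_right _ _)) fun U' hU' => ?_
  obtain ⟨hkF, hsF, h337s, h337F, h337B, hA, hAτ⟩ := F.cplx i α₁ U U' hα₁ hU'
  obtain ⟨hinv1, hinv2, -, -⟩ := H (F.T i) (F.coord i U) (F.blk i) (F.kQ i U) (F.sQ i U) (F.cfun i) (F.w i U)
    (F.dist_nonneg i) (F.triangle i) (F.dist_self i) (F.dist_comm i) (F.len_pos i) (F.eta_le_len i) (F.eta_pos i)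
    (F.h261_of i hδr (F.rate_le_cap δ₀) hM0) (F.hST_of i hδr (F.rate_le_cap δ₀) hM0) (F.unitary i U)
    (F.stencilB i) (F.stencilF i) (F.stencil0 i) (F.w_nonneg i U) (F.card_w i U) (F.hkQ i U) (F.hsQ i U) (F.hcfun i)
    hΔG hGΔ h1 h2 h3 α₁ hα₁.le (le_trans ha (min_le_left _ _)) (F.expA i U U') (F.kF i U U') (F.sF i U U')
    hkF hsF h337s h337F h337B hA hAτ
  have hG := F.gop_eq i ((bg i).mul U' U) _ _ (F.mul_law i α₁ U U' hα₁ hU') hinv1 hinv2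
  rw [F.mul_law i α₁ U U' hα₁ hU', hG]
  exact ⟨hinv1, hinv2⟩

end Literature.MathematicalPhysics.QuantumFieldTheory.Balaban1983to89.B9SectBGpStepAtLettersV2
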